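import Literature.MathematicalPhysics.QuantumFieldTheory.Balaban1983to89.B15Claim189NumericsPin

/-!
# `Balaban1983to89.B15Claim189PrintedConditions` — YM-DAG node N12 · [Balaban1989LargeFieldI] CMP **122** (1989) 175–202, (1.89) p. 198 with p. 200 (the two
# conditions on `N₀` and on `M`) and [Balaban1988Convergent] (2.1) p. 254 (the chain `Ω₁ ⊃ Λ₁ ⊃ Ω₂ ⊃ …`): THE COUNTING INPUTS OF THE (1.89) DISPLAY FIXED (bounded
# levels) AND DISCHARGED INTO PRINT'S TWO CONDITIONS, and THE REGIONS `Ω_j` OF THE (1.89) SITUATION PINNED TO THE TERM'S (2.1)-CHAIN (so that the region bookkeeping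
# `hΩ ∕ hΩtop` of module 4's display theorem IS (2.1)); the term-pinned layer `ResidW.pinD189T` and the (1.89) display at it FROM the (1.80) display

statement-level bookkeeping over published theorems with citation tags; kernel-checked compositions of tree theorems and elementary arithmetic; nothing here is a
claim about the Yang–Mills mass gap.

CITATION HEADER (lean-in-tree rule).  Source: [Balaban1989LargeFieldI] («[IV]»), p. 200, verbatim: *"Now we have to analyze this bound on all the domains in the
definition (1.24). Consider Ω_m∖Ω_{m+1} for k₀ < m < k. We have j = k, and the exponential can be bounded by … hence the last term in the bound (1.98) can be made
arbitrarily small for M large enough. Making it smaller than α, and taking α ≦ 1/8, …"*, *"the right-hand side of (1.98) can be bounded by (4α + O(1)B₃B₅M⁵L₀^{−2(k−j)})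
ε_j(L^{k−j}η)², with an increased O(1). … if O(1)B₃B₅M⁵L₀^{−2(N₀−1)} ≦ 1/4"*; p. 199 (*"We have chosen α = 1/12"*); p. 178 (*"h = k − N"*), p. 181 (*"k₀ = k − N₀"*);
(1.2) p. 178 (the chain's `Ω_j`, `j = h, …, k`, read by (1.3)–(1.4) and (1.24)); [Balaban1988Convergent] («[III]») (2.1) p. 254 (*"Ω₁ ⊃ Λ₁ ⊃ Ω₂ ⊃ Λ₂ ⊃ … ⊃ Ω_k ⊃ Λ_k"*),
(2.18) p. 257 (the summation index).  Seat `pub-ymgap-dag-n12-e` (YM-PLAN Track A, HUMAN RULING D-0062; director-ym R134 row N12 s3 «the (1.80)∕(1.89) + R′ (1.99)–(1.100)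
p.201 chain»), module 11 (generation 4).  BY NAME and UNCHANGED: p29's `B15Claim189Assembly` (`Setting189`, `X`, `new189`, `chiPP`, `dom ∕ domK ∕ half`, `hlast_of_largeM`,
`Ω_antitone`, `half_lt_of_new189`), r12's `B15Claim189Cases.lines124N_of_bounds`, `B15Chi124DetSets.chi124_top_of_lines`, `B15Ineq196Proof.ineq198 ∕ ineq196_first_of_191_195`,
generation 2's `B15Claim189FlowAtRecord` (`hscale_of_flow_bdd`, `eps_D189OfRecord_nonneg ∕ le_of_inInterval`, `hflow_D189OfRecord_of_inInterval`, `betaAlongHistory_le_of_betaUpperH`),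
r11's `B14.Eq218Concrete.Seq ∕ Chain21.Ω_antitone`, def-R's `Node00.SeqOfRecord`, modules 4∕7∕8∕10 (`Sit189`, `D189OfRecord`, `Sit189.pinChi182 ∕ pinDev0 ∕ pinNumerics`,
`deltaPrimeOfRecord`, `dev0OfRecord`, `ResidW.pinD189ν`).

WHY THIS FILE.  After modules 5 and 10 the inputs of the (1.89) display at the record (generation 2's `claim189_D189OfRecord_of_inInterval`; dag-n12-d's `h189` slot at
the fully-lettered layer) that are neither ℍ-leaves nor the (1.80) display are: (a) the three COUNTING inputs `hX' : ∀ j, 2 + X_j ≤ X′` — quantified over ALL levels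
`j : ℕ`, hence reading the thresholds `ε_j` of the junk tail of the generated history beyond the coupling window (the same defect generation 2 repaired for `hε0 ∕ hε1`:
not provable at records as typed) —, `hsmall : X′·(L₀²)^{−(k−k₀−1)} ≤ 1/4` and `hlarge : X_k·e^{−4δM} ≤ α`; (b) the region bookkeeping `hΩ` (nested `Ω_j`) and `hΩtop`
over RESIDUAL regions; (c) `β ∈ [0, 1/4]`, `2 ≤ L₀`, `L₀² ≤ L`, signs; (d) the geometry `hjEqK ∕ hgeom ∕ hbox`.  Here (a) is FIXED — the coefficient `X_j` is asked on the
levels `h ≤ j ≤ k` only (r12's case analysis never reads it elsewhere) — and DISCHARGED into print's two p. 200 conditions in closed form, the «increased O(1)» made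
explicit: on the window `X_j = O(1)(1 + L^{−j}αε_j)²B₃B₅M⁵ ≤ (121/120)²·O(1)B₃B₅M⁵` (`α = 1/12`, `ε_j ≤ 1/10`, `L ≥ 1`), so `hX' ∕ hsmall` ⇐ `(2 + (121/120)²O(1)B₃B₅M⁵)·
(L₀²)^{−(N₀−1)} ≤ 1/4` (*"if O(1)B₃B₅M⁵L₀^{−2(N₀−1)} ≦ 1/4"*) and `hlarge` ⇐ `(121/120)²O(1)B₃B₅M⁵·e^{−4δM} ≤ α` (*"for M large enough. Making it smaller than α"*); and
(b) is PINNED: the top level `k` of the situation is the term's top index `k′` (print §1's *"kth density, instead of k+1st"*; at the W pin `k′ = kSel P + 1` — def-R's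
ANSWER-1 to this seat's QUESTION-1, 2026-08-27: the (1.100) data `λ.D1100 P` are typed at `kSel P + 1`) and the regions `Ω_j` of the situation are the term's (2.1)-chain
`{Ω_j}` of the (2.18) index of record (def-R's `SeqOfRecord`, r11's `Seq`), read on the index window and clamped (`Ω_j := Ω_{max(1, min(j, k′))}`), whereupon `hΩ` IS
(2.1) and `hΩtop` (`Ω_{k+1} := Ω_k`) is an identity.  One term per run is the W carrier's granularity (module 4's located note (i), unchanged): the term is a per-run
parameter `s P : SeqOfRecord … (kSel P + 1)` of the pin.

WHAT THIS FILE PROVES (0 `sorry`; defs `omegaOfChain`, `Node00.Sit189.pinTerm`, `sitOfTerm`, `Node00.ResidW.pinD189T`).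
§1 (generic, p29's `Setting189`) `X_le_of_levels`; **`claim189_assembly_trunc`** (generation 2's `claim189_assembly_bdd` with `hX'` on `h ≤ j ≤ k` ONLY: r12's
   `lines124N_of_bounds` fed the coefficient TRUNCATED to `0` off `[h, k]`); `sdiff_subset_domK_of_nested` ∕ `hjEqK_of_nested` (*"We have j = k"* ⇐ nesting + `Z″_k∩Ω_m ⊆
   Ω_{m+1}`); **`claim189_assembly_printed_of_flow`** (`hX' ∕ hsmall ∕ hlarge` REPLACED by print's two conditions; `hscale ∕ hlast` from the flow relation and the shell
   geometry as in p29's `claim189_assembly_of_flow`).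
§2 (generic, r11's `Seq D k`) `omegaOfChain`, `omegaOfChain_eq` (= `Ω_j` on `1 ≤ j ≤ k`), `omegaOfChain_succ_subset` ((2.1)), `omegaOfChain_top_subset`; `Sit189.pinTerm`
   (`k := k′`, `Ω := omegaOfChain s`) + `rfl` faces, `pinTerm_hΩ`, `pinTerm_hΩtop`, `chiP_pinTerm_pinNumerics_pinChi182_iff` (ORDER: the term pin FIRST — modules 10, 7, 8
   read `k`; module 7 reads `Ω`).
§3 (at the record) `sitOfTerm θ P σ s N₀ p₁ := (((σ.pinTerm s).pinNumerics θ.τ9 N₀).pinChi182 δ′_{k′}).pinDev0 θ.ν` + faces; **`claim189_sitOfTerm_of_inInterval`** ∕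
   `_of_betaUpperH` — the (1.89) display at the term's fully pinned letters with `hhk hk₀ hα hM hΩ hΩtop hε0 hε1 hflow hX' hsmall hlarge hjEqK` ALL THEOREMS OR PRINT'S
   CONDITIONS; `ResidW.pinD189T` (= `pinD189ν` at `(σ P).pinTerm (s P)` with `s P : SeqOfRecord … (kSel P + 1)`, `rfl`) + faces incl. **`pinD189T_levels`** (THE LEVEL PIN
   `k = kSel P + 1`, def-R ANSWER-1), **`h189_pinD189T_of_h180`** (dag-n12-d's `h189` slot at the term-pinned layer from its own `h180` slot and the residue: window,
   `2 ≤ N₀ ≤ N`, `N₀ ≤ kSel P + 1`, β, L₀, signs, print's two conditions, `Z″_k`-vs-`Ω_m`, shell geometry, (1.88) cover, four ℍ-leaves).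

HONEST FRAMING.  Count-neutral: kernel bookkeeping + elementary arithmetic; nothing of Bałaban's asserted ((1.90)–(1.97), (1.80), Proposition 1, positive mass, the cube
cover, the shell geometry and the `Z″`-regions stay displayed); N12 NOT discharged; one finite four-torus programme at fixed `ε`, Bałaban AS PRINTED with locators; nothing
continuum ∕ ℝ⁴ ∕ OS ∕ mass gap ∕ Clay.  No `sorry`, no `axiom`, no `instance`, no `notation`.
-/

noncomputable section

open scoped BigOperators
open MeasureTheory

namespace Literature.MathematicalPhysics.QuantumFieldTheory.Balaban1983to89

namespace B15Claim189PrintedConditions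

/-! ## §1. Generic: the counting coefficient on the levels of the situation; the truncated assembly; print's two conditions -/

section Generic

open B15.BasicStep B15.PrelimIntegrations B15Chi124DetSets B15Claim189Cases B15Ineq196Proof B15Bounds199 B8Eq17ClassAkV1
open GaugeField
open B15Claim189Assembly (Setting189 new189 chiPP X dom domK domH domJ half Ω_antitone half_lt_of_new189 hlast_of_largeM dom_h dom_k dom_j)
open B15Claim189FlowAtRecord (hscale_of_flow_bdd)

variable {P : Params} {G C ι : Type*}

/-- **THE «INCREASED O(1)» MADE EXPLICIT**: on a level where `0 ≤ ε_j ≤ 1/10`, with `α = 1/12`, `L ≥ 1` and `0 ≤ O(1)B₃B₅M⁵`, the coefficient of the last term of (1.98),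
`X_j = O(1)(1 + L^{−j}αε_j)²B₃B₅M⁵`, is at most `(121/120)²·O(1)B₃B₅M⁵` (`L^{−j}αε_j ≤ 1/120`). [cite: Balaban1989LargeFieldI, (1.98) p.200 («with an increased O(1)»), p.199] -/
theorem X_le_of_levels (D : Setting189 P G C ι) (hα : D.α = 1 / 12) (hL : 1 ≤ D.L) (hB : 0 ≤ D.O1 * D.B₃ * D.B₅ * D.M ^ 5) {j : ℕ}
    (hε0 : 0 ≤ D.ε j) (hε1 : D.ε j ≤ 1 / 10) : X D j ≤ (121 / 120) ^ 2 * (D.O1 * D.B₃ * D.B₅ * D.M ^ 5) := by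
  have hL0 : 0 < D.L := by linarith
  have hLinv0 : 0 ≤ (D.L ^ j)⁻¹ := inv_nonneg.mpr (pow_nonneg hL0.le _)
  have hLinv1 : (D.L ^ j)⁻¹ ≤ 1 := inv_le_one_of_one_le₀ (one_le_pow₀ hL)
  have ht0 : 0 ≤ (D.L ^ j)⁻¹ * D.α * D.ε j := by rw [hα]; exact mul_nonneg (mul_nonneg hLinv0 (by norm_num)) hε0
  have ht1 : (D.L ^ j)⁻¹ * D.α * D.ε j ≤ 1 / 120 := by
    rw [hα]
    have h1 : (D.L ^ j)⁻¹ * (1 / 12) ≤ 1 / 12 := by nlinarith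
    have h2 : (D.L ^ j)⁻¹ * (1 / 12) * D.ε j ≤ 1 / 12 * (1 / 10) :=
      mul_le_mul h1 hε1 hε0 (by norm_num)
    linarith
  have hsq : (1 + (D.L ^ j)⁻¹ * D.α * D.ε j) ^ 2 ≤ (121 / 120) ^ 2 := by nlinarith
  have hX : X D j = D.O1 * D.B₃ * D.B₅ * D.M ^ 5 * (1 + (D.L ^ j)⁻¹ * D.α * D.ε j) ^ 2 := by unfold X; ring
  rw [hX, mul_comm ((121 / 120 : ℝ) ^ 2)]
  exact mul_le_mul_of_nonneg_left hsq hB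

/-- *"We have j = k"* on `Ω_m∖Ω_{m+1}` REDUCED TO REGION BOOKKEEPING: with nested `Ω`'s and `m < k`, `Ω_m∖Ω_{m+1}` lies in `Ω_kᶜ`; it lies in the `j = k` ℍ-domain `Ω_kᶜ∖Z″_k`
as soon as `Z″_k ∩ Ω_m ⊆ Ω_{m+1}` (print's located geometric input in its sharper form). [cite: Balaban1989LargeFieldI, p.200 («We have j = k»), p.199 («Ω^c_k∖Z″_k for j = k»)] -/
theorem sdiff_subset_domK_of_nested (D : Setting189 P G C ι) (hΩ : ∀ i, D.Ω (i + 1) ⊆ D.Ω i) {m : ℕ} (hmk : m < D.k)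
    (hZ : D.Zpp D.k ∩ D.Ω m ⊆ D.Ω (m + 1)) : D.Ω m \ D.Ω (m + 1) ⊆ domK D := fun _ hx =>
  ⟨fun hxk => hx.2 (Ω_antitone hΩ (Nat.succ_le_of_lt hmk) hxk), fun hxZ => hx.2 (hZ ⟨hxZ, hx.1⟩)⟩

/-- Module 4's `hjEqK` from nesting and the `Z″_k`-clauses `Z″_k ∩ Ω_m ⊆ Ω_{m+1}`, `k₀ < m < k`. [cite: Balaban1989LargeFieldI, p.200 («Consider Ω_m∖Ω_{m+1} for k₀ < m < k. We have j = k»)] -/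
theorem hjEqK_of_nested (D : Setting189 P G C ι) (hΩ : ∀ i, D.Ω (i + 1) ⊆ D.Ω i)
    (hZ : ∀ m, D.k₀ < m → m < D.k → D.Zpp D.k ∩ D.Ω m ⊆ D.Ω (m + 1)) :
    ∀ m, D.k₀ < m → m < D.k → D.Ω m \ D.Ω (m + 1) ⊆ domK D :=
  fun m hm hmk => sdiff_subset_domK_of_nested D hΩ hmk (hZ m hm hmk)

variable [GaugeGroup G]

/-- **(1.89), THE PROVED PART, AS ONE KERNEL THEOREM — BOUNDED-LEVEL FORM FOR THE COUNTING INPUT TOO**: generation 2's `claim189_assembly_bdd` VERBATIM except that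
*"with an increased O(1)"* (`hX' : 2 + X_j ≤ X′`) is asked at the levels `h ≤ j ≤ k` of the situation only — r12's p. 200 case analysis reads `X_j` on the `Z″`-domains
(`h ≤ j < k`) and `X_k` on `Ω^c_{k₀+1}∖Z″_k` and nowhere else.  Same proof (`ineq196_first_of_191_195`, `ineq198`, `lines124N_of_bounds` fed with the units `E_i` AND the
coefficient `X_j` TRUNCATED to `0` off `[h, k]`, `chi124_top_of_lines`). [cite: Balaban1989LargeFieldI, (1.89) p.198, pp.199–200] -/
theorem claim189_assembly_trunc (D : Setting189 P G C ι) (hhk : D.h ≤ D.k₀) (hk : D.k₀ + 2 ≤ D.k)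
    (hΩ : ∀ i, D.Ω (i + 1) ⊆ D.Ω i) (hΩtop : D.Ω D.k ⊆ D.Ω (D.k + 1))
    -- numerics as printed; the ε-numerics on the levels of the situation only
    (hα : D.α = 1 / 12) (hβ0 : 0 ≤ D.β) (hβ : D.β ≤ 1 / 4) (hL₀ : 2 ≤ D.L₀) (hL₀L : D.L₀ ^ 2 ≤ D.L)
    (hε0 : ∀ i, D.h ≤ i → i ≤ D.k → 0 ≤ D.ε i) (hε1 : ∀ i, D.h ≤ i → i ≤ D.k → D.ε i ≤ 1 / 10)
    (hB : 0 ≤ D.O1 * D.B₃ * D.B₅ * D.M ^ 5) (hδ : 0 ≤ D.δ) (hdist : ∀ p, 0 ≤ D.dist p)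
    -- p. 200: "with an increased O(1)" ON THE LEVELS OF THE SITUATION, "if O(1)B₃B₅M⁵L₀^{−2(N₀−1)} ≦ 1/4"
    {X' : ℝ} (hX' : ∀ j, D.h ≤ j → j ≤ D.k → 2 + X D j ≤ X') (hsmall : X' * ((D.L₀ ^ 2) ^ (D.k - D.k₀ - 1))⁻¹ ≤ 1 / 4)
    -- p. 200: "We have j = k" and "Making [the last term] smaller than α" on Ω_m∖Ω_{m+1}, k₀ < m < k
    (hjEqK : ∀ m, D.k₀ < m → m < D.k → D.Ω m \ D.Ω (m + 1) ⊆ domK D)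
    (hlast : ∀ m, D.k₀ < m → m < D.k → ∀ p ∈ plaqsOf (D.Ω m \ D.Ω (m + 1)),
      X D D.k * Real.exp (-D.δ * D.dist p) ≤ D.α)
    -- p. 199: the [III] flow inequality
    (hscale : ∀ j, D.h ≤ j → j < D.k → D.ε D.k * D.η ^ 2 ≤ (D.L ^ (D.k - j))⁻¹ * E124 D.ε D.L D.η D.k j)
    -- (1.88): the cube cover of the half domain
    (hbox : ∀ p ∈ plaqsOf (half D), D.boxOf p ∈ D.halfcubes ∧ p ∈ D.plaqT (D.boxOf p))
    -- the leaves (1.90)–(1.91), (1.93)–(1.95) on the half domain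
    (L91h : ∀ U, new189 D U → ∀ p ∈ plaqsOf (half D),
      Ineq191 (dist1 (plaqHol (D.Upp U) p)) (D.devV'' U p) D.α ((D.L ^ D.h)⁻¹) (D.ε D.h) (E124 D.ε D.L D.η D.k D.h))
    (L95 : ∀ U, new189 D U → ∀ p ∈ plaqsOf (half D),
      Ineq195 (D.devV'' U p) (dist1 (plaqHol (D.Uhalf U (D.boxOf p)) p)) D.α ((D.L ^ D.h)⁻¹) (D.ε D.h)
        (E124 D.ε D.L D.η D.k D.h))
    -- the leaves of p. 199 on the j-th ℍ-domain: (1.91)[h ↦ j] twice and (1.80)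
    (L91 : ∀ U, new189 D U → ∀ j, D.h ≤ j → j ≤ D.k → ∀ p ∈ plaqsOf (dom D j),
      Ineq191 (dist1 (plaqHol (D.Upp U) p)) (D.dev97 U p) D.α ((D.L ^ j)⁻¹) (D.ε j) (E124 D.ε D.L D.η D.k j))
    (L97 : ∀ U, new189 D U → ∀ j, D.h ≤ j → j ≤ D.k → ∀ p ∈ plaqsOf (dom D j),
      Ineq191 (D.dev97 U p) (D.dev0 U p) D.α ((D.L ^ j)⁻¹) (D.ε j) (E124 D.ε D.L D.η D.k j))
    (L80 : ∀ U, new189 D U → ∀ j, D.h ≤ j → j ≤ D.k → ∀ p ∈ plaqsOf (dom D j),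
      B15.Ineq180 (D.dev0 U p) (D.ε D.k) D.η D.B₃ D.B₅ D.M D.δ (D.dist p) D.O1) :
    Claim189 (new189 D) (chiPP D) := by
  intro U hU
  -- elementary consequences of the numerics
  have hα0 : 0 ≤ D.α := by rw [hα]; norm_num
  have hα8 : D.α ≤ 1 / 8 := by rw [hα]; norm_num
  have hL1 : 1 ≤ D.L := by nlinarith
  have hL0 : 0 < D.L := by linarith
  have hLinv0 : ∀ n : ℕ, 0 ≤ (D.L ^ n)⁻¹ := fun n => by positivity
  have hLinv1 : ∀ n : ℕ, (D.L ^ n)⁻¹ ≤ 1 := fun n => inv_le_one_of_one_le₀ (one_le_pow₀ hL1)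
  have hhK : D.h ≤ D.k := by omega
  have hE : ∀ i, D.h ≤ i → i ≤ D.k → 0 ≤ E124 D.ε D.L D.η D.k i := fun i hi hik => by
    unfold E124; exact mul_nonneg (hε0 i hi hik) (sq_nonneg _)
  have he : 0 ≤ D.ε D.k * D.η ^ 2 := mul_nonneg (hε0 D.k hhK le_rfl) (sq_nonneg _)
  have hXexp : ∀ p : Plaq P 0, 0 ≤ D.O1 * D.B₃ * D.B₅ * D.M ^ 5 * Real.exp (-D.δ * D.dist p) := fun p =>
    mul_nonneg hB (Real.exp_nonneg _)
  have hX0 : ∀ j, 0 ≤ X D j := fun j => by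
    have : X D j = D.O1 * D.B₃ * D.B₅ * D.M ^ 5 * (1 + (D.L ^ j)⁻¹ * D.α * D.ε j) ^ 2 := by unfold X; ring
    rw [this]; exact mul_nonneg hB (sq_nonneg _)
  have hkh : D.k ≠ D.h := by omega
  have hδdist : ∀ p : Plaq P 0, 0 ≤ D.δ * D.dist p := fun p => mul_nonneg hδ (hdist p)
  have hX'2 : 2 ≤ X' := by linarith [hX0 D.k, hX' D.k hhK le_rfl]
  -- the units `E_i` TRUNCATED to `0` off `[h, k]` (never read there): nonnegative at EVERY level, equal to `E_i` on `[h, k]`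
  obtain ⟨E', hE'eq, hE'0⟩ : ∃ E' : ℕ → ℝ, (∀ i, D.h ≤ i → i ≤ D.k → E' i = E124 D.ε D.L D.η D.k i) ∧ (∀ i, 0 ≤ E' i) :=
    ⟨fun i => if D.h ≤ i ∧ i ≤ D.k then E124 D.ε D.L D.η D.k i else 0, fun i hi hik => if_pos ⟨hi, hik⟩, fun i => by
      show 0 ≤ (if D.h ≤ i ∧ i ≤ D.k then E124 D.ε D.L D.η D.k i else 0)
      by_cases hc : D.h ≤ i ∧ i ≤ D.k
      · rw [if_pos hc]; exact hE i hc.1 hc.2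
      · rw [if_neg hc]⟩
  -- the coefficient `X_j` TRUNCATED to `0` off `[h, k]` (never read there): nonnegative and `2 + X_j ≤ X′` at EVERY level, equal to `X_j` on `[h, k]`
  obtain ⟨Xt, hXteq, hXt0, hXt'⟩ : ∃ Xt : ℕ → ℝ, (∀ j, D.h ≤ j → j ≤ D.k → Xt j = X D j) ∧ (∀ j, 0 ≤ Xt j) ∧ (∀ j, 2 + Xt j ≤ X') :=
    ⟨fun j => if D.h ≤ j ∧ j ≤ D.k then X D j else 0, fun j hj hjk => if_pos ⟨hj, hjk⟩, fun j => by
      show 0 ≤ (if D.h ≤ j ∧ j ≤ D.k then X D j else 0)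
      by_cases hc : D.h ≤ j ∧ j ≤ D.k
      · rw [if_pos hc]; exact hX0 j
      · rw [if_neg hc], fun j => by
      show 2 + (if D.h ≤ j ∧ j ≤ D.k then X D j else 0) ≤ X'
      by_cases hc : D.h ≤ j ∧ j ≤ D.k
      · rw [if_pos hc]; exact hX' j hc.1 hc.2
      · rw [if_neg hc]; linarith⟩
  -- the (1.98) bound on the `j`-th ℍ-domain, `h ≦ j ≦ k`, from the three leaves (r12's `ineq198`)
  have h198 : ∀ j, D.h ≤ j → j ≤ D.k → ∀ p ∈ plaqsOf (dom D j),
      dist1 (plaqHol (D.Upp U) p) < (2 * (D.L ^ (D.k - j))⁻¹ + 4 * D.α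
        + D.O1 * (1 + (D.L ^ j)⁻¹ * D.α * D.ε j) ^ 2 * D.B₃ * D.B₅ * D.M ^ 5 * Real.exp (-D.δ * D.dist p)
          * (D.L ^ (D.k - j))⁻¹) * E124 D.ε D.L D.η D.k j := by
    intro j hj hjk p hp
    have hsc : D.ε D.k * D.η ^ 2 ≤ (D.L ^ (D.k - j))⁻¹ * E124 D.ε D.L D.η D.k j := by
      rcases Nat.lt_or_ge j D.k with hlt | hge
      · exact hscale j hj hlt
      · have hjk' : j = D.k := le_antisymm hjk hge
        subst hjk'
        simp [E124]
    exact ineq198 (L91 U hU j hj hjk p hp) (L97 U hU j hj hjk p hp) (L80 U hU j hj hjk p hp) hα0 hα8 (hLinv0 j)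
      (hLinv1 j) (hε0 j hj hjk) (hε1 j hj hjk) (hE j hj hjk) (hXexp p) he hsc (hLinv1 _)
  -- r12's p. 200 case analysis at the plaquette families of the four kinds of domains of (1.24) at n = N, in the truncated units and coefficient
  obtain ⟨h1, h2, h3, h4, h5⟩ := lines124N_of_bounds (fun p => dist1 (plaqHol (D.Upp U) p)) hhk (by omega)
    E' Xt X' (fun i => (1 / 2 : ℝ) ^ (D.k - i + 1)) D.dist hα8 hβ0 hβ hL₀ hL₀L hE'0 hXt0 hXt'
    (fun j => ⟨by positivity, pow_le_one₀ (by norm_num) (by norm_num)⟩) hδdist hsmall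
    (fun m => plaqsOf (D.Ω m \ D.Ω (m + 1))) (plaqsOf ((D.Ω (D.k₀ + 1))ᶜ \ D.Zpp D.k)) (fun i => plaqsOf (dom D i))
    (plaqsOf (half D))
    (by
      -- Ω_m∖Ω_{m+1}, k₀ < m < k: "We have j = k", last term ≦ α
      intro m hm hmk p hp
      have hp' : p ∈ plaqsOf (dom D D.k) := by
        rw [dom_k D hkh]; exact plaqsOf_mono (hjEqK m hm hmk) hp
      refine ⟨X D D.k * Real.exp (-D.δ * D.dist p), hlast m hm hmk p hp, ?_⟩
      have h := h198 D.k hhK le_rfl p hp'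
      simp only [Nat.sub_self, pow_zero, inv_one] at h
      rw [hE'eq D.k hhK le_rfl]
      unfold X
      exact h)
    (by
      -- Ω^c_{k₀+1}∖Z″_k ⊆ Ω^c_k∖Z″_k (nested Ω's), j = k
      intro p hp
      have hsub : (D.Ω (D.k₀ + 1))ᶜ \ D.Zpp D.k ⊆ domK D := fun x hx =>
        ⟨fun hxk => hx.1 (Ω_antitone hΩ (by omega : D.k₀ + 1 ≤ D.k) hxk), hx.2⟩
      have hp' : p ∈ plaqsOf (dom D D.k) := by
        rw [dom_k D hkh]; exact plaqsOf_mono hsub hp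
      have h := h198 D.k hhK le_rfl p hp'
      rw [hE'eq D.k hhK le_rfl, hXteq D.k hhK le_rfl]
      unfold X
      exact h)
    (by
      -- the Z″-domains, h ≦ j < k
      intro j hj hjk' p hp
      have h := h198 j hj hjk'.le p hp
      rw [hE'eq j hj hjk'.le, hXteq j hj hjk'.le]
      unfold X
      exact h)
    (by
      -- the half domain: (1.91), (1.95), χ_{h,1/2} ⇒ (1.96)₁
      intro p hp
      rw [hE'eq D.h le_rfl hhK]
      exact ineq196_first_of_191_195 (L91h U hU p hp) (L95 U hU p hp) (half_lt_of_new189 D hU hbox hp) hα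
        (hLinv0 D.h) (hLinv1 D.h) (hε0 D.h le_rfl hhK) (hε1 D.h le_rfl hhK) (hE D.h le_rfl hhK))
  -- back to the units `E_i` on `[h, k]`, then the families cover the concrete regions of (1.24) at n = N
  refine chi124_top_of_lines D.Ω D.Zpp hk (D.Upp U) (fun m => plaqsOf (D.Ω m \ D.Ω (m + 1)))
    (plaqsOf ((D.Ω (D.k₀ + 1))ᶜ \ D.Zpp D.k)) (fun i => plaqsOf (dom D i)) (plaqsOf (half D)) (fun m _ _ => subset_rfl) ?_
    subset_rfl ?_ ?_ ?_ ?_ ?_ ?_ ?_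
  · -- the top region Ω_{k−1}∖Ω_{k+1} ⊆ Ω_{k−1}∖Ω_k (Ω_{k+1} := Ω_k)
    have hk1 : D.k - 1 + 1 = D.k := by omega
    show plaqsOf (D.Ω (D.k - 1) \ D.Ω (D.k + 1)) ⊆ plaqsOf (D.Ω (D.k - 1) \ D.Ω (D.k - 1 + 1))
    rw [hk1]
    exact plaqsOf_mono fun x hx => ⟨hx.1, fun hxk => hx.2 (hΩtop hxk)⟩
  · -- Z″_{i+1}∖Z″_i, h < i < k
    intro i hi hik
    show plaqsOf (D.Zpp (i + 1) \ D.Zpp i) ⊆ plaqsOf (dom D i)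
    rw [dom_j D (by omega) (by omega)]
    exact subset_rfl
  · -- Z″_{h+1}∩Ω_h ⊆ (Z″_{h+1}∩Ω_h∩Ω″^∼_{h+1}) ∪ ((Ω″^∼_{h+1})ᶜ∩Ω_h)
    show plaqsOf (D.Zpp (D.h + 1) ∩ D.Ω D.h) ⊆ plaqsOf (dom D D.h) ∪ plaqsOf (half D)
    rw [dom_h]
    have hcover : D.Zpp (D.h + 1) ∩ D.Ω D.h ⊆ domH D ∪ half D := by
      intro x hx
      by_cases hxT : x ∈ D.OmT
      · exact Or.inl ⟨hx, hxT⟩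
      · exact Or.inr ⟨hxT, hx.2⟩
    intro p hp
    rcases plaqsOf_mono hcover hp with h1 | h1 | h1 | h1 <;> rcases h1 with h | h
    · exact Or.inl (Or.inl h)
    · exact Or.inr (Or.inl h)
    · exact Or.inl (Or.inr (Or.inl h))
    · exact Or.inr (Or.inr (Or.inl h))
    · exact Or.inl (Or.inr (Or.inr (Or.inl h)))
    · exact Or.inr (Or.inr (Or.inr (Or.inl h)))
    · exact Or.inl (Or.inr (Or.inr (Or.inr h)))
    · exact Or.inr (Or.inr (Or.inr (Or.inr h)))
  · intro hk2 p hp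
    rw [← hE'eq D.k hhK le_rfl]
    exact h1 hk2 p hp
  · intro m hm hmk p hp
    rw [← hE'eq D.k hhK le_rfl]
    exact h2 m hm hmk p hp
  · intro p hp
    rw [← hE'eq D.k hhK le_rfl]
    exact h3 p hp
  · intro i hi hik p hp
    rw [← hE'eq i hi hik.le]
    exact h4 i hi hik p hp
  · intro p hp
    rw [← hE'eq D.h le_rfl hhK]
    exact h5 p hp

/-- **(1.89), THE PROVED PART, WITH THE COUNTING INPUTS REPLACED BY PRINT'S TWO CONDITIONS** (and the two derived inputs traced to their printed sources as in p29's
`claim189_assembly_of_flow`): *"if O(1)B₃B₅M⁵L₀^{−2(N₀−1)} ≦ 1/4"* «with an increased O(1)» in the closed form `(2 + (121/120)²O(1)B₃B₅M⁵)·(L₀²)^{−(k−k₀−1)} ≤ 1/4`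
(`hN₀`; `k − k₀ = N₀`), and *"can be made arbitrarily small for M large enough. Making it smaller than α"* in the closed form `(121/120)²O(1)B₃B₅M⁵·e^{−4δM} ≤ α`
(`hMlarge`); `hX' ∕ hsmall ∕ hlarge` of the assembly then follow from `X_le_of_levels` on the levels `h ≤ j ≤ k`, `hscale` from the [III] flow relation `hflow`
(`hscale_of_flow_bdd`), `hlast` from the shell geometry `hgeom` (`hlast_of_largeM`). [cite: Balaban1989LargeFieldI, (1.89) p.198, pp.199–200] -/
theorem claim189_assembly_printed_of_flow (D : Setting189 P G C ι) (hhk : D.h ≤ D.k₀) (hk : D.k₀ + 2 ≤ D.k)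
    (hΩ : ∀ i, D.Ω (i + 1) ⊆ D.Ω i) (hΩtop : D.Ω D.k ⊆ D.Ω (D.k + 1))
    (hα : D.α = 1 / 12) (hβ0 : 0 ≤ D.β) (hβ : D.β ≤ 1 / 4) (hL₀ : 2 ≤ D.L₀) (hL₀L : D.L₀ ^ 2 ≤ D.L)
    (hε0 : ∀ i, D.h ≤ i → i ≤ D.k → 0 ≤ D.ε i) (hε1 : ∀ i, D.h ≤ i → i ≤ D.k → D.ε i ≤ 1 / 10)
    (hB : 0 ≤ D.O1 * D.B₃ * D.B₅ * D.M ^ 5) (hδ : 0 ≤ D.δ) (hM : 0 ≤ D.M) (hdist : ∀ p, 0 ≤ D.dist p)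
    -- p. 200: PRINT'S TWO CONDITIONS on N₀ = k − k₀ and on M
    (hN₀ : (2 + (121 / 120) ^ 2 * (D.O1 * D.B₃ * D.B₅ * D.M ^ 5)) * ((D.L₀ ^ 2) ^ (D.k - D.k₀ - 1))⁻¹ ≤ 1 / 4)
    (hMlarge : (121 / 120) ^ 2 * (D.O1 * D.B₃ * D.B₅ * D.M ^ 5) * Real.exp (-(4 * D.δ * D.M)) ≤ D.α)
    -- p. 200: "We have j = k" and the shell geometry on Ω_m∖Ω_{m+1}, k₀ < m < k
    (hjEqK : ∀ m, D.k₀ < m → m < D.k → D.Ω m \ D.Ω (m + 1) ⊆ domK D)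
    (hgeom : ∀ m, D.k₀ < m → m < D.k → ∀ p ∈ plaqsOf (D.Ω m \ D.Ω (m + 1)), 4 * ((m : ℝ) - D.k₀) * D.M ≤ D.dist p)
    -- p. 199: the [III] flow relation
    {β₀ : ℝ} (hβ₀0 : 0 ≤ β₀) (hβ₀ : β₀ ≤ 1 / 2)
    (hflow : ∀ j, D.h ≤ j → j < D.k → D.ε D.k ≤ (1 + β₀) * Real.sqrt ((D.k - j : ℕ) : ℝ) * D.ε j)
    -- (1.88): the cube cover of the half domain; the leaves
    (hbox : ∀ p ∈ plaqsOf (half D), D.boxOf p ∈ D.halfcubes ∧ p ∈ D.plaqT (D.boxOf p))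
    (L91h : ∀ U, new189 D U → ∀ p ∈ plaqsOf (half D),
      Ineq191 (dist1 (plaqHol (D.Upp U) p)) (D.devV'' U p) D.α ((D.L ^ D.h)⁻¹) (D.ε D.h) (E124 D.ε D.L D.η D.k D.h))
    (L95 : ∀ U, new189 D U → ∀ p ∈ plaqsOf (half D),
      Ineq195 (D.devV'' U p) (dist1 (plaqHol (D.Uhalf U (D.boxOf p)) p)) D.α ((D.L ^ D.h)⁻¹) (D.ε D.h)
        (E124 D.ε D.L D.η D.k D.h))
    (L91 : ∀ U, new189 D U → ∀ j, D.h ≤ j → j ≤ D.k → ∀ p ∈ plaqsOf (dom D j),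
      Ineq191 (dist1 (plaqHol (D.Upp U) p)) (D.dev97 U p) D.α ((D.L ^ j)⁻¹) (D.ε j) (E124 D.ε D.L D.η D.k j))
    (L97 : ∀ U, new189 D U → ∀ j, D.h ≤ j → j ≤ D.k → ∀ p ∈ plaqsOf (dom D j),
      Ineq191 (D.dev97 U p) (D.dev0 U p) D.α ((D.L ^ j)⁻¹) (D.ε j) (E124 D.ε D.L D.η D.k j))
    (L80 : ∀ U, new189 D U → ∀ j, D.h ≤ j → j ≤ D.k → ∀ p ∈ plaqsOf (dom D j),
      B15.Ineq180 (D.dev0 U p) (D.ε D.k) D.η D.B₃ D.B₅ D.M D.δ (D.dist p) D.O1) :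
    Claim189 (new189 D) (chiPP D) := by
  have hL1 : 1 ≤ D.L := by nlinarith
  have hL2 : 2 ≤ D.L := by nlinarith
  have hhK : D.h ≤ D.k := by omega
  have hXb : ∀ j, D.h ≤ j → j ≤ D.k → X D j ≤ (121 / 120) ^ 2 * (D.O1 * D.B₃ * D.B₅ * D.M ^ 5) := fun j hj hjk =>
    X_le_of_levels D hα hL1 hB (hε0 j hj hjk) (hε1 j hj hjk)
  have hX0k : 0 ≤ X D D.k := by
    have : X D D.k = D.O1 * D.B₃ * D.B₅ * D.M ^ 5 * (1 + (D.L ^ D.k)⁻¹ * D.α * D.ε D.k) ^ 2 := by unfold X; ring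
    rw [this]; exact mul_nonneg hB (sq_nonneg _)
  have hlarge : X D D.k * Real.exp (-(4 * D.δ * D.M)) ≤ D.α :=
    (mul_le_mul_of_nonneg_right (hXb D.k hhK le_rfl) (Real.exp_nonneg _)).trans hMlarge
  refine claim189_assembly_trunc D hhk hk hΩ hΩtop hα hβ0 hβ hL₀ hL₀L hε0 hε1 hB hδ hdist
    (X' := 2 + (121 / 120) ^ 2 * (D.O1 * D.B₃ * D.B₅ * D.M ^ 5)) (fun j hj hjk => by linarith [hXb j hj hjk]) hN₀ hjEqK ?_
    (hscale_of_flow_bdd D hL2 hβ₀0 hβ₀ hε0 hflow) hbox L91h L95 L91 L97 L80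
  intro m hm hmk p hp
  exact hlast_of_largeM D hδ hM hX0k hlarge hm (hgeom m hm hmk p hp) le_rfl

end Generic

/-! ## §2. Generic: the regions `Ω_j` of the (1.89) situation FROM THE TERM'S (2.1)-CHAIN -/

section Chain

open B14.Eq218Concrete (Seq)

variable {α : Type*} {D : ℕ → Set (Set α)} {k : ℕ}

/-- **THE CHAIN'S `Ω_j` ON THE INDEX WINDOW, CLAMPED**: for an admissible sequence `s` ((2.18) index, window `1 ≤ j ≤ k`), `omegaOfChain s j := Ω_{max(1, min(j, k))}` —
on the window it IS `Ω_j`; below it is `Ω₁`, above it is `Ω_k` (module 4's convention `Ω_{k+1} := Ω_k`, p29's HONEST SCOPE (vi)). [cite: Balaban1988Convergent, (2.1) p.254, (2.18) p.257; Balaban1989LargeFieldI, (1.2) p.178] -/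
def omegaOfChain (s : Seq D k) : ℕ → Set α := fun j => s.Ω (max 1 (min j k))

/-- Unfolding (`rfl`). [cite: Balaban1988Convergent, (2.1) p.254 (bookkeeping)] -/
theorem omegaOfChain_apply (s : Seq D k) (j : ℕ) : omegaOfChain s j = s.Ω (max 1 (min j k)) := rfl

/-- On the index window the clamped chain IS the chain: `omegaOfChain s j = Ω_j` for `1 ≤ j ≤ k`. [cite: Balaban1988Convergent, (2.1) p.254] -/
theorem omegaOfChain_eq (s : Seq D k) {j : ℕ} (h1 : 1 ≤ j) (hj : j ≤ k) : omegaOfChain s j = s.Ω j := by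
  simp only [omegaOfChain, min_eq_left hj, max_eq_right h1]

/-- **MODULE 4's `hΩ` IS (2.1)**: *"Ω₁ ⊃ Λ₁ ⊃ Ω₂ ⊃ Λ₂ ⊃ … ⊃ Ω_k ⊃ Λ_k"* — the clamped chain is nested at EVERY index (r11's `Chain21.Ω_antitone` on the window; constant off
it). [cite: Balaban1988Convergent, (2.1) p.254] -/
theorem omegaOfChain_succ_subset (s : Seq D k) (i : ℕ) : omegaOfChain s (i + 1) ⊆ omegaOfChain s i := by
  by_cases hk : 1 ≤ k
  · show s.Ω (max 1 (min (i + 1) k)) ⊆ s.Ω (max 1 (min i k))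
    exact s.chain.Ω_antitone (le_max_left 1 _) (max_le_max le_rfl (min_le_min (Nat.le_succ i) le_rfl))
      (max_le hk (min_le_right _ _))
  · have hk0 : k = 0 := by omega
    subst hk0
    have h : omegaOfChain s (i + 1) = omegaOfChain s i := by
      simp only [omegaOfChain, Nat.min_zero]
    exact h.subset

/-- **MODULE 4's `hΩtop`** (`Ω_{k+1} := Ω_k` at the top of (1.24)): above the chain's top index the clamped chain is constant, so `Ω_K ⊆ Ω_{K+1}` for every `K ≥ k`.
[cite: Balaban1989LargeFieldI, (1.24) p.182, p.200 («for m = k − 1»); Balaban1988Convergent, (2.1) p.254] -/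
theorem omegaOfChain_top_subset (s : Seq D k) {K : ℕ} (hK : k ≤ K) : omegaOfChain s K ⊆ omegaOfChain s (K + 1) := by
  have h : omegaOfChain s K = omegaOfChain s (K + 1) := by
    simp only [omegaOfChain, min_eq_right hK, min_eq_right (hK.trans (Nat.le_succ K))]
  exact h.subset

end Chain

section PinTerm

open DagBinding T4Continuum Node00
open B14.Eq218Concrete (Seq)
open B15Sect1ChartInstances (bondsB0)

variable {F : T4Family} {N : ℕ} [NeZero N]

/-- **THE (1.89) SITUATION OF A TERM: TOP LEVEL AND REGIONS `Ω_j` PINNED TO THE TERM'S (2.1)-CHAIN**: `k := k′` = the term's top index (print §1's *"kth density"*, the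
density the term tower indexes; at NODE 00's W pin `k′ = kSel P + 1`, def-R ANSWER-1 2026-08-27) and `Ω := omegaOfChain s` for an admissible sequence `s` of top index `k′`
over any class `𝐃` of regions of the torus (at the record: def-R's `SeqOfRecord F ν M g K k′` over `DOfRecord`); everything else — `h, k₀` (re-pinned from `k` by module 10's
numbers pin), `Z″_j, Z, Λ, Ω″^∼_{h+1}, Ω″^{∼2}_{h+1}`, cube data, numbers, letters — unchanged.  ORDER: this pin comes FIRST (modules 10, 7, 8 read `k`).  Data, no law.
[cite: Balaban1989LargeFieldI, p.177 («we consider the kth density, instead of k+1st»), (1.2) p.178, (1.24) pp.181–182, (1.89) p.198; Balaban1988Convergent, (2.1) p.254, (2.18) p.257] -/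
def _root_.Literature.MathematicalPhysics.QuantumFieldTheory.Balaban1983to89.Node00.Sit189.pinTerm {K : ℕ} (σ : Sit189 F N K)
    {D : ℕ → Set (Set (Site (F.P K) 0))} {k' : ℕ} (s : Seq D k') : Sit189 F N K :=
  { σ with k := k', Ω := omegaOfChain s }

variable {K : ℕ} (σ : Sit189 F N K) {D : ℕ → Set (Set (Site (F.P K) 0))} {k' : ℕ} (s : Seq D k')

/-- The pinned top level and regions (`rfl`). [cite: Balaban1988Convergent, (2.1) p.254, (2.18) p.257 (bookkeeping)] -/
theorem pinTerm_k_Ω : (σ.pinTerm s).k = k' ∧ (σ.pinTerm s).Ω = omegaOfChain s := ⟨rfl, rfl⟩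

/-- On the chain's index window the pinned `Ω_j` IS the term's `Ω_j`. [cite: Balaban1988Convergent, (2.1) p.254; Balaban1989LargeFieldI, (1.2) p.178] -/
theorem pinTerm_Ω_eq {j : ℕ} (h1 : 1 ≤ j) (hj : j ≤ k') : (σ.pinTerm s).Ω j = s.Ω j := omegaOfChain_eq s h1 hj

/-- The pin keeps the lower levels (re-pinned from `k` by module 10's numbers pin) and the cube sides (`rfl`). [cite: Balaban1989LargeFieldI, (1.24) p.181 (bookkeeping)] -/
theorem pinTerm_levels_kept : (σ.pinTerm s).h = σ.h ∧ (σ.pinTerm s).k₀ = σ.k₀ ∧ (σ.pinTerm s).sh = σ.sh ∧ (σ.pinTerm s).sk = σ.sk := ⟨rfl, rfl, rfl, rfl⟩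

/-- The pin keeps the other regions (`rfl`). [cite: Balaban1989LargeFieldI, (1.20) p.181, (1.75) p.193, (1.81) p.195 (bookkeeping)] -/
theorem pinTerm_regions_kept : (σ.pinTerm s).Zpp = σ.Zpp ∧ (σ.pinTerm s).Z = σ.Z ∧ (σ.pinTerm s).Λ = σ.Λ ∧ (σ.pinTerm s).OmT = σ.OmT ∧ (σ.pinTerm s).ΩppT2 = σ.ΩppT2 :=
  ⟨rfl, rfl, rfl, rfl, rfl⟩

/-- The pin keeps the chart carrier and the (1.82) letter (`rfl`; `HEq` for the carrier-dependent letter). [cite: Balaban1989LargeFieldI, (1.82) p.196 (bookkeeping)] -/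
theorem pinTerm_𝔤_chiP : (σ.pinTerm s).𝔤 = σ.𝔤 ∧ HEq (σ.pinTerm s).chiP σ.chiP := ⟨rfl, HEq.rfl⟩

/-- The pin keeps numbers, `dist`, cube families and the deviation letters (`rfl`). [cite: Balaban1989LargeFieldI, (1.80) p.195, (1.88)–(1.90) pp.197–198 (bookkeeping)] -/
theorem pinTerm_numbers_cubes : (σ.pinTerm s).β = σ.β ∧ (σ.pinTerm s).L₀ = σ.L₀ ∧ (σ.pinTerm s).α = σ.α ∧ (σ.pinTerm s).δ = σ.δ ∧ (σ.pinTerm s).B₃ = σ.B₃ ∧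
    (σ.pinTerm s).B₅ = σ.B₅ ∧ (σ.pinTerm s).M = σ.M ∧ (σ.pinTerm s).O1 = σ.O1 ∧ (σ.pinTerm s).dist = σ.dist ∧ (σ.pinTerm s).Xhalf = σ.Xhalf ∧ (σ.pinTerm s).XH = σ.XH ∧
    (σ.pinTerm s).XΩ4 = σ.XΩ4 ∧ (σ.pinTerm s).boxOf = σ.boxOf ∧ (σ.pinTerm s).dev0 = σ.dev0 ∧ (σ.pinTerm s).devV'' = σ.devV'' ∧ (σ.pinTerm s).dev97 = σ.dev97 :=
  ⟨rfl, rfl, rfl, rfl, rfl, rfl, rfl, rfl, rfl, rfl, rfl, rfl, rfl, rfl, rfl, rfl⟩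

/-- **Module 4's `hΩ` AT THE PIN IS A THEOREM** ((2.1)). [cite: Balaban1988Convergent, (2.1) p.254] -/
theorem pinTerm_hΩ : ∀ i, (σ.pinTerm s).Ω (i + 1) ⊆ (σ.pinTerm s).Ω i := omegaOfChain_succ_subset s

/-- **Module 4's `hΩtop` AT THE PIN IS A THEOREM** (the top level IS the term's top index). [cite: Balaban1989LargeFieldI, (1.24) p.182, p.200; Balaban1988Convergent, (2.1) p.254] -/
theorem pinTerm_hΩtop : (σ.pinTerm s).Ω (σ.pinTerm s).k ⊆ (σ.pinTerm s).Ω ((σ.pinTerm s).k + 1) := omegaOfChain_top_subset s le_rfl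

/-- **ORDER OF PINS — the numbers, the (1.82) instance and the (1.80) letter READ the top level and the regions**: module 7's χ′-pin applied after this pin and module 10's
numbers pin tests `|B′(b)| < δ′` on the bonds of `𝔹₀` built with the term's `Ω_j` and the levels `k′ − N, k′` (`Iff.rfl`). [cite: Balaban1989LargeFieldI, (1.82) p.196, (1.81) p.195, p.178] -/
theorem chiP_pinTerm_pinNumerics_pinChi182_iff (τ : TowerNumerics) (N₀ : ℕ) (δ' : ℝ) (B' : (j : ℕ) → VecField (F.P K) j (EuclideanSpace ℝ (Fin (N ^ 2 - 1)))) :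
    (((σ.pinTerm s).pinNumerics τ N₀).pinChi182 δ').chiP B' ↔ ∀ j, ∀ b ∈ bondsB0 (omegaOfChain s) σ.Zpp σ.Z σ.Λ σ.ΩppT2 (k' - τ.Nmem) k' j, ‖B' j b‖ < δ' :=
  Iff.rfl

end PinTerm

/-! ## §3. At NODE 00's record: the term's fully pinned situation, the (1.89) display at it, the term-pinned residual layer -/

section AtRecord

open DagBinding T4Continuum Node00
open B15 (Ineq180)
open B15.BasicStep (Claim189)
open B15.PrelimIntegrations (Ineq191 Ineq195)
open B15Chi124DetSets (E124)
open B15Claim189Assembly (Setting189 new189 chiPP X dom domK half)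
open B15Claim189PinAtRecord (D189OfRecord)
open B15Claim189PinNonVacuity (deltaPrimeOfRecord)
open B15Claim189FlowAtRecord (eps_D189OfRecord_nonneg_of_inInterval eps_D189OfRecord_le_of_inInterval hflow_D189OfRecord_of_inInterval
  betaAlongHistory_le_of_betaUpperH)
open B15Claim189NumericsPin (pinNumerics_h_le_k₀ pinNumerics_k₀_add_two_le_k pinNumerics_B_nonneg)
open B15Ineq180PinAtRecord (dev0OfRecord)
open B15Sect1ChartInstances (bondsB0)
open B15DeterminingSets (MSField)
open B14DomainGeom (Pt)
open B8Eq17ClassAkV1 (plaqsOf)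
open GaugeGroup (dist1)
open GaugeField (plaqHol)
open FlowStep (prefixOf BetaUpperH)
open B14FlowStep (SmallnessFor)

variable {F : T4Family} {N : ℕ} [NeZero N]

/-- **THE (1.89) SITUATION OF A TERM, FULLY PINNED**: top level `k := k′` and regions `Ω_j` := the term's (2.1)-chain (`s : SeqOfRecord` of top index `k′`), THEN the numbers of
record (module 10: `M := τ9.M`, `α := 1/12`, `h := k′ − N`, `k₀ := k′ − N₀`), THEN the (1.82) instance with `δ′_{k′}` of record (module 7), THEN the (1.80) deviation of record at
level `k′` (module 8).  Residual: the regions `Z″_j, Z, Λ, Ω″^∼_{h+1}, Ω″^{∼2}_{h+1}`, cube data, `β, L₀, δ, B₃, B₅, O(1)`, `dist`, `devV″, dev97`.  Data, no law.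
[cite: Balaban1989LargeFieldI, (1.89) p.198, p.177, (1.2) p.178, p.181, (1.80) p.195, (1.82) p.196, p.199; Balaban1988Convergent, (2.1) p.254, (2.18) p.257] -/
def sitOfTerm (θ : Stage9Params F N) (P : B12.RunParams) (σ : Sit189 F N P.K) {k' : ℕ}
    (s : SeqOfRecord F θ.ν θ.τ9.M (gOfRecord₁₀ F N θ P) P.K k') (N₀ p₁ : ℕ) : Sit189 F N P.K :=
  (((σ.pinTerm s).pinNumerics θ.τ9 N₀).pinChi182 (deltaPrimeOfRecord F N θ P p₁ k')).pinDev0 θ.ν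

variable (θ : Stage9Params F N) (P : B12.RunParams) (σ : Sit189 F N P.K) {k' : ℕ}
  (s : SeqOfRecord F θ.ν θ.τ9.M (gOfRecord₁₀ F N θ P) P.K k') (N₀ p₁ : ℕ)

/-- Unfolding: the four pins in order (`rfl`). [cite: Balaban1989LargeFieldI, (1.89) p.198 (bookkeeping)] -/
theorem sitOfTerm_eq : sitOfTerm θ P σ s N₀ p₁ = (((σ.pinTerm s).pinNumerics θ.τ9 N₀).pinChi182 (deltaPrimeOfRecord F N θ P p₁ k')).pinDev0 θ.ν := rfl

/-- Its regions `Ω_j` ARE the term's clamped chain; the other regions are the situation's (`rfl`). [cite: Balaban1988Convergent, (2.1) p.254; Balaban1989LargeFieldI, (1.2) p.178 (bookkeeping)] -/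
theorem sitOfTerm_regions : (sitOfTerm θ P σ s N₀ p₁).Ω = omegaOfChain s ∧ (sitOfTerm θ P σ s N₀ p₁).Zpp = σ.Zpp ∧ (sitOfTerm θ P σ s N₀ p₁).Z = σ.Z ∧
    (sitOfTerm θ P σ s N₀ p₁).Λ = σ.Λ ∧ (sitOfTerm θ P σ s N₀ p₁).OmT = σ.OmT ∧ (sitOfTerm θ P σ s N₀ p₁).ΩppT2 = σ.ΩppT2 := ⟨rfl, rfl, rfl, rfl, rfl, rfl⟩

/-- On the window its `Ω_j` IS the term's `Ω_j`. [cite: Balaban1988Convergent, (2.1) p.254; Balaban1989LargeFieldI, (1.2) p.178] -/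
theorem sitOfTerm_Ω_eq {j : ℕ} (h1 : 1 ≤ j) (hj : j ≤ k') : (sitOfTerm θ P σ s N₀ p₁).Ω j = s.Ω j := omegaOfChain_eq s h1 hj

/-- Its levels: `h = k′ − N`, `k₀ = k′ − N₀`, `k = k′` (`rfl`). [cite: Balaban1989LargeFieldI, p.177, p.178, p.181 (bookkeeping)] -/
theorem sitOfTerm_levels : (sitOfTerm θ P σ s N₀ p₁).h = k' - θ.τ9.Nmem ∧ (sitOfTerm θ P σ s N₀ p₁).k₀ = k' - N₀ ∧ (sitOfTerm θ P σ s N₀ p₁).k = k' :=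
  ⟨rfl, rfl, rfl⟩

/-- Its numbers: `M = τ9.M`, `α = 1/12`; `β, L₀, δ, B₃, B₅, O(1)`, `dist` the situation's (`rfl`). [cite: Balaban1989LargeFieldI, (1.80) p.195, p.199 (bookkeeping)] -/
theorem sitOfTerm_numbers : (sitOfTerm θ P σ s N₀ p₁).M = (θ.τ9.M : ℝ) ∧ (sitOfTerm θ P σ s N₀ p₁).α = 1 / 12 ∧ (sitOfTerm θ P σ s N₀ p₁).β = σ.β ∧
    (sitOfTerm θ P σ s N₀ p₁).L₀ = σ.L₀ ∧ (sitOfTerm θ P σ s N₀ p₁).δ = σ.δ ∧ (sitOfTerm θ P σ s N₀ p₁).B₃ = σ.B₃ ∧ (sitOfTerm θ P σ s N₀ p₁).B₅ = σ.B₅ ∧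
    (sitOfTerm θ P σ s N₀ p₁).O1 = σ.O1 ∧ (sitOfTerm θ P σ s N₀ p₁).dist = σ.dist := ⟨rfl, rfl, rfl, rfl, rfl, rfl, rfl, rfl, rfl⟩

/-- Its cube data and the two residual deviation letters are the situation's (`rfl`). [cite: Balaban1989LargeFieldI, (1.88)–(1.90) pp.197–198, (1.97) p.199 (bookkeeping)] -/
theorem sitOfTerm_cubes : (sitOfTerm θ P σ s N₀ p₁).sh = σ.sh ∧ (sitOfTerm θ P σ s N₀ p₁).sk = σ.sk ∧ (sitOfTerm θ P σ s N₀ p₁).Xhalf = σ.Xhalf ∧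
    (sitOfTerm θ P σ s N₀ p₁).XH = σ.XH ∧ (sitOfTerm θ P σ s N₀ p₁).XΩ4 = σ.XΩ4 ∧ (sitOfTerm θ P σ s N₀ p₁).boxOf = σ.boxOf ∧
    (sitOfTerm θ P σ s N₀ p₁).devV'' = σ.devV'' ∧ (sitOfTerm θ P σ s N₀ p₁).dev97 = σ.dev97 := ⟨rfl, rfl, rfl, rfl, rfl, rfl, rfl, rfl⟩

/-- Its (1.80) letter is `|U_{k′,Z}(V_Λ)(∂q) − 1|` of record at level `k′` and its chart carrier is NODE 00's `ℝ^{N²−1}` (`rfl`). [cite: Balaban1989LargeFieldI, (1.79)–(1.80) p.195, (1.82) p.196 (bookkeeping)] -/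
theorem sitOfTerm_dev0_𝔤 : (sitOfTerm θ P σ s N₀ p₁).dev0 = dev0OfRecord F N θ.ν P.K σ.Z σ.Λ k' ∧ (sitOfTerm θ P σ s N₀ p₁).𝔤 = EuclideanSpace ℝ (Fin (N ^ 2 - 1)) :=
  ⟨rfl, rfl⟩

/-- Its (1.82) function: `|B′(b)| < δ′_{k′}` of record on the bonds of `𝔹₀` built with the PINNED regions and levels (`Iff.rfl`). [cite: Balaban1989LargeFieldI, (1.82) p.196, p.183] -/
theorem sitOfTerm_chiP_iff (B' : (j : ℕ) → VecField (F.P P.K) j (EuclideanSpace ℝ (Fin (N ^ 2 - 1)))) :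
    (sitOfTerm θ P σ s N₀ p₁).chiP B' ↔
      ∀ j, ∀ b ∈ bondsB0 (omegaOfChain s) σ.Zpp σ.Z σ.Λ σ.ΩppT2 (k' - θ.τ9.Nmem) k' j, ‖B' j b‖ < deltaPrimeOfRecord F N θ P p₁ k' := Iff.rfl

variable {θ}

/-- **(1.89) AT THE TERM'S FULLY PINNED LETTERS OF RECORD — every input that is a function of the record, of the term, of print's fixed numbers or of the run's window A
THEOREM; the counting inputs PRINT'S TWO CONDITIONS.**  For `D = D189OfRecord θ P (sitOfTerm θ P σ s N₀ p₁)` (stated with a defining equation `hD`; instantiate with `rfl`):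
`Claim189 (new189 D) (chiPP D)` FROM — levels: `2 ≤ N₀ ≤ N`, `N₀ ≤ k′`; residual numerics: `0 ≤ β ≤ 1/4`, `2 ≤ L₀`, `L₀² ≤ L`, `0 ≤ O(1)B₃B₅`, `0 ≤ δ`, `dist ≥ 0`; PRINT'S TWO
CONDITIONS (p. 200) *"if O(1)B₃B₅M⁵L₀^{−2(N₀−1)} ≦ 1/4"* (`hN₀`, increased O(1) explicit) and *"for M large enough. Making it smaller than α"* (`hMl`) with the record's `M`; the
run's window up to `k′`, `β ≤ β′` along the history, `SmallnessFor`, `β₀ ≤ ½`, `0 ≤ A₀`, `γA₀(log γ⁻²)^{p₀} ≤ 1/10`; the located geometry — `Z″_{k′} ∩ Ω_m ⊆ Ω_{m+1}` for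
`k₀ < m < k′` (*"We have j = k"*), the shell bound `4(m − k₀)M ≤ dist(p, Λ)` on `Ω_m∖Ω_{m+1}`, the (1.88) cube cover of the half domain; the four ℍ-leaves (1.90)–(1.91),
(1.93)–(1.95), p. 199's two (1.91)-type bounds; and (1.80) at `U₀ = U_{k′,Z}(V_Λ)` of record.  DISCHARGED by name: `hhk ∕ hk₀` (module 10), `hα` (`rfl`), `hM` (cast),
`hΩ ∕ hΩtop` (§2, (2.1)), `hε0 ∕ hε1 ∕ hflow` (module 5, the window), `hX' ∕ hsmall ∕ hlarge ∕ hjEqK` (§1).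
[cite: Balaban1989LargeFieldI, (1.89) p.198, pp.199–200, (1.80) p.195; Balaban1988Convergent, (2.1) p.254, (2.8) p.256] -/
theorem claim189_sitOfTerm_of_inInterval
    {D : Setting189 (F.P P.K) (SU N) (MSField (F.P P.K) (SU N) × ((j : ℕ) → VecField (F.P P.K) j (EuclideanSpace ℝ (Fin (N ^ 2 - 1))))) (Pt (F.P P.K).d)}
    (hD : D = D189OfRecord θ P (sitOfTerm θ P σ s N₀ p₁))
    -- levels
    (hN2 : 2 ≤ N₀) (hNN : N₀ ≤ θ.τ9.Nmem) (hNk : N₀ ≤ k')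
    -- residual numerics
    (hβ0 : 0 ≤ σ.β) (hβ : σ.β ≤ 1 / 4) (hL₀ : 2 ≤ σ.L₀) (hL₀L : σ.L₀ ^ 2 ≤ ((F.P P.K).L : ℝ))
    (hB : 0 ≤ σ.O1 * σ.B₃ * σ.B₅) (hδ : 0 ≤ σ.δ) (hdist : ∀ p, 0 ≤ σ.dist p)
    -- print's two conditions, p. 200
    (hN₀ : (2 + (121 / 120) ^ 2 * (σ.O1 * σ.B₃ * σ.B₅ * (θ.τ9.M : ℝ) ^ 5)) * ((σ.L₀ ^ 2) ^ (N₀ - 1))⁻¹ ≤ 1 / 4)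
    (hMl : (121 / 120) ^ 2 * (σ.O1 * σ.B₃ * σ.B₅ * (θ.τ9.M : ℝ) ^ 5) * Real.exp (-(4 * σ.δ * (θ.τ9.M : ℝ))) ≤ 1 / 12)
    -- the window and the flow numerics
    (hA₀ : 0 ≤ θ.ν.A₀) {β' β₀ : ℝ} {L : ℕ} (S : SmallnessFor θ.γ β' β₀ L θ.ν.p₀) (hβ₀ : β₀ ≤ 1 / 2)
    (hε10 : θ.γ * p0Profile θ.ν.A₀ θ.ν.p₀ θ.γ ≤ 1 / 10)
    (hI : Step.InInterval θ.γ k' (gOfRecord₁₀ F N θ P))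
    (hub : ∀ j, j < k' → betaOfRecord₁₀ F N θ j (prefixOf (gOfRecord₁₀ F N θ P) j) ≤ β')
    -- the located geometry
    (hZk : ∀ m, k' - N₀ < m → m < k' → σ.Zpp k' ∩ omegaOfChain s m ⊆ omegaOfChain s (m + 1))
    (hgeom : ∀ m, D.k₀ < m → m < D.k → ∀ p ∈ plaqsOf (D.Ω m \ D.Ω (m + 1)), 4 * ((m : ℝ) - D.k₀) * D.M ≤ D.dist p)
    (hbox : ∀ p ∈ plaqsOf (half D), D.boxOf p ∈ D.halfcubes ∧ p ∈ D.plaqT (D.boxOf p))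
    -- the ℍ-leaves and (1.80)
    (L91h : ∀ U, new189 D U → ∀ p ∈ plaqsOf (half D),
      Ineq191 (dist1 (plaqHol (D.Upp U) p)) (D.devV'' U p) D.α ((D.L ^ D.h)⁻¹) (D.ε D.h) (E124 D.ε D.L D.η D.k D.h))
    (L95 : ∀ U, new189 D U → ∀ p ∈ plaqsOf (half D),
      Ineq195 (D.devV'' U p) (dist1 (plaqHol (D.Uhalf U (D.boxOf p)) p)) D.α ((D.L ^ D.h)⁻¹) (D.ε D.h) (E124 D.ε D.L D.η D.k D.h))
    (L91 : ∀ U, new189 D U → ∀ j, D.h ≤ j → j ≤ D.k → ∀ p ∈ plaqsOf (dom D j),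
      Ineq191 (dist1 (plaqHol (D.Upp U) p)) (D.dev97 U p) D.α ((D.L ^ j)⁻¹) (D.ε j) (E124 D.ε D.L D.η D.k j))
    (L97 : ∀ U, new189 D U → ∀ j, D.h ≤ j → j ≤ D.k → ∀ p ∈ plaqsOf (dom D j),
      Ineq191 (D.dev97 U p) (D.dev0 U p) D.α ((D.L ^ j)⁻¹) (D.ε j) (E124 D.ε D.L D.η D.k j))
    (L80 : ∀ U, new189 D U → ∀ j, D.h ≤ j → j ≤ D.k → ∀ p ∈ plaqsOf (dom D j),
      Ineq180 (D.dev0 U p) (D.ε D.k) D.η D.B₃ D.B₅ D.M D.δ (D.dist p) D.O1) :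
    Claim189 (new189 D) (chiPP D) := by
  subst hD
  have hN₀' : (2 + (121 / 120) ^ 2 * (σ.O1 * σ.B₃ * σ.B₅ * (θ.τ9.M : ℝ) ^ 5)) * ((σ.L₀ ^ 2) ^ (k' - (k' - N₀) - 1))⁻¹ ≤ 1 / 4 := by
    rw [show k' - (k' - N₀) - 1 = N₀ - 1 from by omega]; exact hN₀
  exact claim189_assembly_printed_of_flow (D189OfRecord θ P (sitOfTerm θ P σ s N₀ p₁))
    (pinNumerics_h_le_k₀ (σ.pinTerm s) θ.τ9 N₀ hNN) (pinNumerics_k₀_add_two_le_k (σ.pinTerm s) θ.τ9 N₀ hN2 hNk)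
    (omegaOfChain_succ_subset s) (omegaOfChain_top_subset s le_rfl) rfl hβ0 hβ hL₀ hL₀L
    (eps_D189OfRecord_nonneg_of_inInterval P (sitOfTerm θ P σ s N₀ p₁) hA₀ S.γ_lt_one.le hI)
    (eps_D189OfRecord_le_of_inInterval P (sitOfTerm θ P σ s N₀ p₁) hA₀ S hε10 hI)
    (pinNumerics_B_nonneg (σ.pinTerm s) θ.τ9 N₀ hB) hδ (Nat.cast_nonneg _) hdist hN₀' hMl
    (hjEqK_of_nested _ (omegaOfChain_succ_subset s) hZk) hgeom S.β₀_pos.le hβ₀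
    (hflow_D189OfRecord_of_inInterval P (sitOfTerm θ P σ s N₀ p₁) hA₀ S hI hub) hbox L91h L95 L91 L97 L80

/-- **The same from the BOX bound on the β-functions of record** (`BetaUpperH β′ θ.γ (betaOfRecord₁₀ θ)`; the binder N24's glue carries `βfun ≤ βup` on `]0, γ₀]^{k+1}`).
[cite: Balaban1987RG1, §1 p.264; Balaban1989LargeFieldI, (1.89) p.198, pp.199–200] -/
theorem claim189_sitOfTerm_of_betaUpperH
    {D : Setting189 (F.P P.K) (SU N) (MSField (F.P P.K) (SU N) × ((j : ℕ) → VecField (F.P P.K) j (EuclideanSpace ℝ (Fin (N ^ 2 - 1))))) (Pt (F.P P.K).d)}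
    (hD : D = D189OfRecord θ P (sitOfTerm θ P σ s N₀ p₁))
    (hN2 : 2 ≤ N₀) (hNN : N₀ ≤ θ.τ9.Nmem) (hNk : N₀ ≤ k')
    (hβ0 : 0 ≤ σ.β) (hβ : σ.β ≤ 1 / 4) (hL₀ : 2 ≤ σ.L₀) (hL₀L : σ.L₀ ^ 2 ≤ ((F.P P.K).L : ℝ))
    (hB : 0 ≤ σ.O1 * σ.B₃ * σ.B₅) (hδ : 0 ≤ σ.δ) (hdist : ∀ p, 0 ≤ σ.dist p)
    (hN₀ : (2 + (121 / 120) ^ 2 * (σ.O1 * σ.B₃ * σ.B₅ * (θ.τ9.M : ℝ) ^ 5)) * ((σ.L₀ ^ 2) ^ (N₀ - 1))⁻¹ ≤ 1 / 4)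
    (hMl : (121 / 120) ^ 2 * (σ.O1 * σ.B₃ * σ.B₅ * (θ.τ9.M : ℝ) ^ 5) * Real.exp (-(4 * σ.δ * (θ.τ9.M : ℝ))) ≤ 1 / 12)
    (hA₀ : 0 ≤ θ.ν.A₀) {β' β₀ : ℝ} {L : ℕ} (S : SmallnessFor θ.γ β' β₀ L θ.ν.p₀) (hβ₀ : β₀ ≤ 1 / 2)
    (hε10 : θ.γ * p0Profile θ.ν.A₀ θ.ν.p₀ θ.γ ≤ 1 / 10)
    (hI : Step.InInterval θ.γ k' (gOfRecord₁₀ F N θ P)) (hup : BetaUpperH β' θ.γ (betaOfRecord₁₀ F N θ))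
    (hZk : ∀ m, k' - N₀ < m → m < k' → σ.Zpp k' ∩ omegaOfChain s m ⊆ omegaOfChain s (m + 1))
    (hgeom : ∀ m, D.k₀ < m → m < D.k → ∀ p ∈ plaqsOf (D.Ω m \ D.Ω (m + 1)), 4 * ((m : ℝ) - D.k₀) * D.M ≤ D.dist p)
    (hbox : ∀ p ∈ plaqsOf (half D), D.boxOf p ∈ D.halfcubes ∧ p ∈ D.plaqT (D.boxOf p))
    (L91h : ∀ U, new189 D U → ∀ p ∈ plaqsOf (half D),
      Ineq191 (dist1 (plaqHol (D.Upp U) p)) (D.devV'' U p) D.α ((D.L ^ D.h)⁻¹) (D.ε D.h) (E124 D.ε D.L D.η D.k D.h))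
    (L95 : ∀ U, new189 D U → ∀ p ∈ plaqsOf (half D),
      Ineq195 (D.devV'' U p) (dist1 (plaqHol (D.Uhalf U (D.boxOf p)) p)) D.α ((D.L ^ D.h)⁻¹) (D.ε D.h) (E124 D.ε D.L D.η D.k D.h))
    (L91 : ∀ U, new189 D U → ∀ j, D.h ≤ j → j ≤ D.k → ∀ p ∈ plaqsOf (dom D j),
      Ineq191 (dist1 (plaqHol (D.Upp U) p)) (D.dev97 U p) D.α ((D.L ^ j)⁻¹) (D.ε j) (E124 D.ε D.L D.η D.k j))
    (L97 : ∀ U, new189 D U → ∀ j, D.h ≤ j → j ≤ D.k → ∀ p ∈ plaqsOf (dom D j),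
      Ineq191 (D.dev97 U p) (D.dev0 U p) D.α ((D.L ^ j)⁻¹) (D.ε j) (E124 D.ε D.L D.η D.k j))
    (L80 : ∀ U, new189 D U → ∀ j, D.h ≤ j → j ≤ D.k → ∀ p ∈ plaqsOf (dom D j),
      Ineq180 (D.dev0 U p) (D.ε D.k) D.η D.B₃ D.B₅ D.M D.δ (D.dist p) D.O1) :
    Claim189 (new189 D) (chiPP D) :=
  claim189_sitOfTerm_of_inInterval P σ s N₀ p₁ hD hN2 hNN hNk hβ0 hβ hL₀ hL₀L hB hδ hdist hN₀ hMl hA₀ S hβ₀ hε10 hI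
    (betaAlongHistory_le_of_betaUpperH hup hI) hZk hgeom hbox L91h L95 L91 L97 L80

/-- **THE RESIDUAL [IV] LAYER WITH THE (1.89) LETTERS PINNED TO THE RECORD'S OBJECTS INCLUDING THE LEVEL `k = kSel P + 1` AND THE TERM'S REGIONS** (def-R ANSWER-1 to this
seat's QUESTION-1, 2026-08-27: *«print-§1's density index k in (1.89) IS the tree level `kSel P + 1` of the R-side objects»* — the (1.100) data `λ.D1100 P` are already typed at
`kSel P + 1`): module 10's fully-lettered pin `pinD189ν` at the term-pinned situations — per run `P`, ONE term `s P` of the (2.18) index of record at top index `kSel P + 1`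
(the W carrier's granularity: one (1.89) situation per run; module 4's located note (i)).  Data, no law. [cite: Balaban1989LargeFieldI, (1.89) p.198, p.177, (1.2) p.178, (1.100) p.201; Balaban1988Convergent, (2.1) p.254, (2.18) p.257] -/
def _root_.Literature.MathematicalPhysics.QuantumFieldTheory.Balaban1983to89.Node00.ResidW.pinD189T (lam : ResidW F N) (θ : Stage9Params F N)
    (σ : ∀ P : B12.RunParams, Sit189 F N P.K)
    (s : ∀ P : B12.RunParams, SeqOfRecord F θ.ν θ.τ9.M (gOfRecord₁₀ F N θ P) P.K (lam.kSel P + 1)) (N₀ p₁ : ℕ) : ResidW F N :=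
  lam.pinD189ν θ (fun P => (σ P).pinTerm (s P)) N₀ p₁

variable (θ) (lam : ResidW F N) (σT : ∀ P : B12.RunParams, Sit189 F N P.K)
  (sT : ∀ P : B12.RunParams, SeqOfRecord F θ.ν θ.τ9.M (gOfRecord₁₀ F N θ P) P.K (lam.kSel P + 1))

/-- The term-pinned layer IS module 10's fully-lettered pin at the term-pinned situations (`rfl`). [cite: Balaban1989LargeFieldI, (1.89) p.198 (bookkeeping)] -/
theorem pinD189T_eq : lam.pinD189T θ σT sT N₀ p₁ = lam.pinD189ν θ (fun P => (σT P).pinTerm (sT P)) N₀ p₁ := rfl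

/-- Its (1.89) letters at run `P` ARE module 4's letters of record at the term's fully pinned situation (`rfl`). [cite: Balaban1989LargeFieldI, (1.89) p.198 (bookkeeping)] -/
theorem pinD189T_D189 (P : B12.RunParams) : (lam.pinD189T θ σT sT N₀ p₁).D189 P = D189OfRecord θ P (sitOfTerm θ P (σT P) (sT P) N₀ p₁) := rfl

/-- **THE LEVEL PIN**: the (1.89) letters of run `P` sit at top level `k = kSel P + 1`, bottom `h = kSel P + 1 − N`, middle `k₀ = kSel P + 1 − N₀` (`rfl`).
[cite: Balaban1989LargeFieldI, p.177 («kth density, instead of k+1st»), p.178 («h = k − N»), p.181 («k₀ = k − N₀»)] -/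
theorem pinD189T_levels (P : B12.RunParams) : ((lam.pinD189T θ σT sT N₀ p₁).D189 P).k = lam.kSel P + 1 ∧
    ((lam.pinD189T θ σT sT N₀ p₁).D189 P).h = lam.kSel P + 1 - θ.τ9.Nmem ∧ ((lam.pinD189T θ σT sT N₀ p₁).D189 P).k₀ = lam.kSel P + 1 - N₀ := ⟨rfl, rfl, rfl⟩

/-- The pin keeps the step selector, the Proposition-1 carrier and the (1.100) data (`rfl`). [cite: Balaban1989LargeFieldI, (0.2) p.176, Prop. 1 p.194, (1.100) p.201 (bookkeeping)] -/
theorem pinD189T_kSel_LF_D1100 : (lam.pinD189T θ σT sT N₀ p₁).kSel = lam.kSel ∧ (lam.pinD189T θ σT sT N₀ p₁).LF = lam.LF ∧ (lam.pinD189T θ σT sT N₀ p₁).D1100 = lam.D1100 :=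
  ⟨rfl, rfl, rfl⟩

/-- The pin commutes with module 2's (1.100) pin (`rfl`; the (1.100) pin keeps `kSel`, so the same term selector serves). [cite: Balaban1989LargeFieldI, (1.89) p.198, (1.100) p.201 (bookkeeping)] -/
theorem pinD189T_pinRPrime_comm : (lam.pinD189T θ σT sT N₀ p₁).pinRPrime θ = (lam.pinRPrime θ).pinD189T θ σT sT N₀ p₁ := rfl

/-- The regions of the pinned letters at run `P`: `Ω_j` = the term's clamped chain, read off the window as the term's own `Ω_j` (`1 ≤ j ≤ kSel P + 1`).
[cite: Balaban1988Convergent, (2.1) p.254; Balaban1989LargeFieldI, (1.2) p.178] -/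
theorem pinD189T_Ω (P : B12.RunParams) {j : ℕ} (h1 : 1 ≤ j) (hj : j ≤ lam.kSel P + 1) : ((lam.pinD189T θ σT sT N₀ p₁).D189 P).Ω j = (sT P).Ω j :=
  omegaOfChain_eq (sT P) h1 hj

variable {θ}

/-- **dag-n12-d's `h189` SLOT AT THE TERM-PINNED LAYER FROM ITS OWN `h180` SLOT** (both in the shape of `…N12AtRecord12Pointed.b15Leaf_WOfRecord₁₀_pinAllχ₀_of_deg_massSel`,
read at `σ := P ↦ ((σ P).pinTerm (s P)).pinNumerics θ.τ9 N₀`): for the letters `D := (λ.pinD189T θ σ s N₀ p₁).D189 P`, the (1.89) display `Claim189 (new189 D) (chiPP D)` from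
the (1.80) display (`h180`), the four ℍ-leaves, the located geometry, the residual numerics `β, L₀`, the signs, print's two p. 200 conditions, the levels `2 ≤ N₀ ≤ N`,
`N₀ ≤ kSel P + 1`, and the run's window up to `kSel P + 1` (BOX form of the β bound). [cite: Balaban1989LargeFieldI, (1.89) p.198, pp.199–200, (1.80) p.195; Balaban1988Convergent, (2.1) p.254, (2.8) p.256] -/
theorem h189_pinD189T_of_h180 (P : B12.RunParams)
    (hN2 : 2 ≤ N₀) (hNN : N₀ ≤ θ.τ9.Nmem) (hNk : N₀ ≤ lam.kSel P + 1)
    (hβ0 : 0 ≤ (σT P).β) (hβ : (σT P).β ≤ 1 / 4) (hL₀ : 2 ≤ (σT P).L₀) (hL₀L : (σT P).L₀ ^ 2 ≤ ((F.P P.K).L : ℝ))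
    (hB : 0 ≤ (σT P).O1 * (σT P).B₃ * (σT P).B₅) (hδ : 0 ≤ (σT P).δ) (hdist : ∀ p, 0 ≤ (σT P).dist p)
    (hN₀ : (2 + (121 / 120) ^ 2 * ((σT P).O1 * (σT P).B₃ * (σT P).B₅ * (θ.τ9.M : ℝ) ^ 5)) * (((σT P).L₀ ^ 2) ^ (N₀ - 1))⁻¹ ≤ 1 / 4)
    (hMl : (121 / 120) ^ 2 * ((σT P).O1 * (σT P).B₃ * (σT P).B₅ * (θ.τ9.M : ℝ) ^ 5) * Real.exp (-(4 * (σT P).δ * (θ.τ9.M : ℝ))) ≤ 1 / 12)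
    (hA₀ : 0 ≤ θ.ν.A₀) {β' β₀ : ℝ} {L : ℕ} (S : SmallnessFor θ.γ β' β₀ L θ.ν.p₀) (hβ₀ : β₀ ≤ 1 / 2)
    (hε10 : θ.γ * p0Profile θ.ν.A₀ θ.ν.p₀ θ.γ ≤ 1 / 10)
    (hI : Step.InInterval θ.γ (lam.kSel P + 1) (gOfRecord₁₀ F N θ P)) (hup : BetaUpperH β' θ.γ (betaOfRecord₁₀ F N θ))
    (hZk : ∀ m, lam.kSel P + 1 - N₀ < m → m < lam.kSel P + 1 → (σT P).Zpp (lam.kSel P + 1) ∩ omegaOfChain (sT P) m ⊆ omegaOfChain (sT P) (m + 1))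
    (hgeom : ∀ m, ((lam.pinD189T θ σT sT N₀ p₁).D189 P).k₀ < m → m < ((lam.pinD189T θ σT sT N₀ p₁).D189 P).k →
      ∀ p ∈ plaqsOf (((lam.pinD189T θ σT sT N₀ p₁).D189 P).Ω m \ ((lam.pinD189T θ σT sT N₀ p₁).D189 P).Ω (m + 1)),
        4 * ((m : ℝ) - ((lam.pinD189T θ σT sT N₀ p₁).D189 P).k₀) * ((lam.pinD189T θ σT sT N₀ p₁).D189 P).M ≤ ((lam.pinD189T θ σT sT N₀ p₁).D189 P).dist p)
    (hbox : ∀ p ∈ plaqsOf (half ((lam.pinD189T θ σT sT N₀ p₁).D189 P)),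
      ((lam.pinD189T θ σT sT N₀ p₁).D189 P).boxOf p ∈ ((lam.pinD189T θ σT sT N₀ p₁).D189 P).halfcubes ∧
        p ∈ ((lam.pinD189T θ σT sT N₀ p₁).D189 P).plaqT (((lam.pinD189T θ σT sT N₀ p₁).D189 P).boxOf p))
    (L91h : ∀ U, new189 ((lam.pinD189T θ σT sT N₀ p₁).D189 P) U → ∀ p ∈ plaqsOf (half ((lam.pinD189T θ σT sT N₀ p₁).D189 P)),
      Ineq191 (dist1 (plaqHol (((lam.pinD189T θ σT sT N₀ p₁).D189 P).Upp U) p)) (((lam.pinD189T θ σT sT N₀ p₁).D189 P).devV'' U p)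
        ((lam.pinD189T θ σT sT N₀ p₁).D189 P).α ((((lam.pinD189T θ σT sT N₀ p₁).D189 P).L ^ ((lam.pinD189T θ σT sT N₀ p₁).D189 P).h)⁻¹)
        (((lam.pinD189T θ σT sT N₀ p₁).D189 P).ε ((lam.pinD189T θ σT sT N₀ p₁).D189 P).h)
        (E124 ((lam.pinD189T θ σT sT N₀ p₁).D189 P).ε ((lam.pinD189T θ σT sT N₀ p₁).D189 P).L ((lam.pinD189T θ σT sT N₀ p₁).D189 P).η
          ((lam.pinD189T θ σT sT N₀ p₁).D189 P).k ((lam.pinD189T θ σT sT N₀ p₁).D189 P).h))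
    (L95 : ∀ U, new189 ((lam.pinD189T θ σT sT N₀ p₁).D189 P) U → ∀ p ∈ plaqsOf (half ((lam.pinD189T θ σT sT N₀ p₁).D189 P)),
      Ineq195 (((lam.pinD189T θ σT sT N₀ p₁).D189 P).devV'' U p)
        (dist1 (plaqHol (((lam.pinD189T θ σT sT N₀ p₁).D189 P).Uhalf U (((lam.pinD189T θ σT sT N₀ p₁).D189 P).boxOf p)) p))
        ((lam.pinD189T θ σT sT N₀ p₁).D189 P).α ((((lam.pinD189T θ σT sT N₀ p₁).D189 P).L ^ ((lam.pinD189T θ σT sT N₀ p₁).D189 P).h)⁻¹)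
        (((lam.pinD189T θ σT sT N₀ p₁).D189 P).ε ((lam.pinD189T θ σT sT N₀ p₁).D189 P).h)
        (E124 ((lam.pinD189T θ σT sT N₀ p₁).D189 P).ε ((lam.pinD189T θ σT sT N₀ p₁).D189 P).L ((lam.pinD189T θ σT sT N₀ p₁).D189 P).η
          ((lam.pinD189T θ σT sT N₀ p₁).D189 P).k ((lam.pinD189T θ σT sT N₀ p₁).D189 P).h))
    (L91 : ∀ U, new189 ((lam.pinD189T θ σT sT N₀ p₁).D189 P) U → ∀ j, ((lam.pinD189T θ σT sT N₀ p₁).D189 P).h ≤ j → j ≤ ((lam.pinD189T θ σT sT N₀ p₁).D189 P).k →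
      ∀ p ∈ plaqsOf (dom ((lam.pinD189T θ σT sT N₀ p₁).D189 P) j),
        Ineq191 (dist1 (plaqHol (((lam.pinD189T θ σT sT N₀ p₁).D189 P).Upp U) p)) (((lam.pinD189T θ σT sT N₀ p₁).D189 P).dev97 U p)
          ((lam.pinD189T θ σT sT N₀ p₁).D189 P).α ((((lam.pinD189T θ σT sT N₀ p₁).D189 P).L ^ j)⁻¹) (((lam.pinD189T θ σT sT N₀ p₁).D189 P).ε j)
          (E124 ((lam.pinD189T θ σT sT N₀ p₁).D189 P).ε ((lam.pinD189T θ σT sT N₀ p₁).D189 P).L ((lam.pinD189T θ σT sT N₀ p₁).D189 P).η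
            ((lam.pinD189T θ σT sT N₀ p₁).D189 P).k j))
    (L97 : ∀ U, new189 ((lam.pinD189T θ σT sT N₀ p₁).D189 P) U → ∀ j, ((lam.pinD189T θ σT sT N₀ p₁).D189 P).h ≤ j → j ≤ ((lam.pinD189T θ σT sT N₀ p₁).D189 P).k →
      ∀ p ∈ plaqsOf (dom ((lam.pinD189T θ σT sT N₀ p₁).D189 P) j),
        Ineq191 (((lam.pinD189T θ σT sT N₀ p₁).D189 P).dev97 U p) (((lam.pinD189T θ σT sT N₀ p₁).D189 P).dev0 U p)
          ((lam.pinD189T θ σT sT N₀ p₁).D189 P).α ((((lam.pinD189T θ σT sT N₀ p₁).D189 P).L ^ j)⁻¹) (((lam.pinD189T θ σT sT N₀ p₁).D189 P).ε j)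
          (E124 ((lam.pinD189T θ σT sT N₀ p₁).D189 P).ε ((lam.pinD189T θ σT sT N₀ p₁).D189 P).L ((lam.pinD189T θ σT sT N₀ p₁).D189 P).η
            ((lam.pinD189T θ σT sT N₀ p₁).D189 P).k j))
    (h180 : ∀ U, new189 ((lam.pinD189T θ σT sT N₀ p₁).D189 P) U →
      ∀ i, ((lam.pinD189T θ σT sT N₀ p₁).D189 P).h ≤ i → i ≤ ((lam.pinD189T θ σT sT N₀ p₁).D189 P).k →
        ∀ q ∈ plaqsOf (dom ((lam.pinD189T θ σT sT N₀ p₁).D189 P) i),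
          Ineq180 (((lam.pinD189T θ σT sT N₀ p₁).D189 P).dev0 U q) (((lam.pinD189T θ σT sT N₀ p₁).D189 P).ε ((lam.pinD189T θ σT sT N₀ p₁).D189 P).k)
            ((lam.pinD189T θ σT sT N₀ p₁).D189 P).η ((lam.pinD189T θ σT sT N₀ p₁).D189 P).B₃ ((lam.pinD189T θ σT sT N₀ p₁).D189 P).B₅
            ((lam.pinD189T θ σT sT N₀ p₁).D189 P).M ((lam.pinD189T θ σT sT N₀ p₁).D189 P).δ (((lam.pinD189T θ σT sT N₀ p₁).D189 P).dist q)
            ((lam.pinD189T θ σT sT N₀ p₁).D189 P).O1) :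
    Claim189 (new189 ((lam.pinD189T θ σT sT N₀ p₁).D189 P)) (chiPP ((lam.pinD189T θ σT sT N₀ p₁).D189 P)) :=
  claim189_sitOfTerm_of_betaUpperH P (σT P) (sT P) N₀ p₁ rfl hN2 hNN hNk hβ0 hβ hL₀ hL₀L hB hδ hdist hN₀ hMl hA₀ S hβ₀ hε10 hI hup hZk hgeom hbox
    L91h L95 L91 L97 h180

end AtRecord

/-! ## §4. (v1.1) The window-free form — flow inputs displayed, for witness lines whose `γ` is not (2.7)-small (`SmallnessFor` is unsatisfiable at `γ ≥ 1/2`) — and the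
unit-configuration test at the term pin -/

section WindowFree

open DagBinding T4Continuum Node00
open B15 (Ineq180)
open B15.BasicStep (Claim189)
open B15.PrelimIntegrations (Ineq191 Ineq195)
open B15Chi124DetSets (E124)
open B15Claim189Assembly (Setting189 new189 chiPP X dom domK half)
open B15Claim189PinAtRecord (D189OfRecord)
open B15Claim189NumericsPin (pinNumerics_h_le_k₀ pinNumerics_k₀_add_two_le_k pinNumerics_B_nonneg displays_tested_at_one_pinD189ν_of_admissible)
open B15DeterminingSets (MSField)
open B14DomainGeom (Pt)
open B8Eq17ClassAkV1 (plaqsOf)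
open GaugeGroup (dist1)
open GaugeField (plaqHol)
open B14FlowStep (SmallnessFor)

variable {F : T4Family} {N : ℕ} [NeZero N]

/-- **[III] (2.7)'s SMALLNESS IS UNSATISFIABLE AT `γ ≥ 1/2`** (kernel census for the witness lines: node00-def-K0a's `theta12LiveOfRecord` has `γ = 1/2`): `SmallnessFor γ β′ β₀ L p`
asks `4p + 2 ≤ log γ⁻²`, but `log γ⁻² ≤ log 4 < 2` for `γ ≥ 1/2`.  So on such a line module 5's window-based discharge of `hε0 ∕ hε1 ∕ hflow` is unavailable and the flow inputs
of (1.89) stay DISPLAYED (`claim189_sitOfTerm_of_flow` below); a witness with `log γ⁻² ≥ 4p₀ + 2` re-enables `claim189_sitOfTerm_of_inInterval`. [cite: Balaban1988Convergent, (2.7) p.255] -/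
theorem not_smallnessFor_of_half_le {γ β' β₀ : ℝ} {L p : ℕ} (hγ : 1 / 2 ≤ γ) : ¬ SmallnessFor γ β' β₀ L p := by
  intro S
  have h27 := S.h27a
  have hp : (0 : ℝ) ≤ p := Nat.cast_nonneg _
  have hγ0 : 0 < γ := S.γ_pos
  have hsq : (1 / 2 : ℝ) ^ 2 ≤ γ ^ 2 := pow_le_pow_left₀ (by norm_num) hγ 2
  have h1 : (γ ^ 2)⁻¹ ≤ 4 := by
    have h4 : (γ ^ 2)⁻¹ ≤ ((1 / 2 : ℝ) ^ 2)⁻¹ := inv_anti₀ (by norm_num) hsq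
    norm_num at h4
    exact h4
  have h2 : Real.log (γ ^ 2)⁻¹ ≤ Real.log 4 := Real.log_le_log (by positivity) h1
  have h3 : Real.log 4 < 2 := by
    have h22 : Real.log 4 = 2 * Real.log 2 := by
      rw [show (4 : ℝ) = 2 ^ 2 by norm_num, Real.log_pow]; norm_num
    rw [h22]
    have := Real.log_two_lt_d9
    linarith
  linarith

variable {θ : Stage9Params F N} (P : B12.RunParams) (σ : Sit189 F N P.K) {k' : ℕ}
  (s : SeqOfRecord F θ.ν θ.τ9.M (gOfRecord₁₀ F N θ P) P.K k') (N₀ p₁ : ℕ)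

/-- **(1.89) AT THE TERM'S FULLY PINNED LETTERS — WINDOW-FREE FORM**: as `claim189_sitOfTerm_of_inInterval` but with the flow inputs DISPLAYED instead of read off the run's
window: `0 ≤ ε_i ≤ 1/10` on the levels `k′ − N ≤ i ≤ k′` and the [III] (2.8) relation `ε_{k′} ≤ (1+β₀)(k′−j)^{1/2}ε_j` (`h ≤ j < k′`) with `0 ≤ β₀ ≤ ½`, for the thresholds of record
`ε_j = epsOfRecord θ.ν (gOfRecord₁₀ θ P) j`.  For witness lines whose `γ` is not (2.7)-small (`not_smallnessFor_of_half_le`). [cite: Balaban1989LargeFieldI, (1.89) p.198, pp.199–200; Balaban1988Convergent, (2.8) p.256] -/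
theorem claim189_sitOfTerm_of_flow
    {D : Setting189 (F.P P.K) (SU N) (MSField (F.P P.K) (SU N) × ((j : ℕ) → VecField (F.P P.K) j (EuclideanSpace ℝ (Fin (N ^ 2 - 1))))) (Pt (F.P P.K).d)}
    (hD : D = D189OfRecord θ P (sitOfTerm θ P σ s N₀ p₁))
    (hN2 : 2 ≤ N₀) (hNN : N₀ ≤ θ.τ9.Nmem) (hNk : N₀ ≤ k')
    (hβ0 : 0 ≤ σ.β) (hβ : σ.β ≤ 1 / 4) (hL₀ : 2 ≤ σ.L₀) (hL₀L : σ.L₀ ^ 2 ≤ ((F.P P.K).L : ℝ))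
    (hB : 0 ≤ σ.O1 * σ.B₃ * σ.B₅) (hδ : 0 ≤ σ.δ) (hdist : ∀ p, 0 ≤ σ.dist p)
    (hN₀ : (2 + (121 / 120) ^ 2 * (σ.O1 * σ.B₃ * σ.B₅ * (θ.τ9.M : ℝ) ^ 5)) * ((σ.L₀ ^ 2) ^ (N₀ - 1))⁻¹ ≤ 1 / 4)
    (hMl : (121 / 120) ^ 2 * (σ.O1 * σ.B₃ * σ.B₅ * (θ.τ9.M : ℝ) ^ 5) * Real.exp (-(4 * σ.δ * (θ.τ9.M : ℝ))) ≤ 1 / 12)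
    -- the flow inputs DISPLAYED
    (hε0 : ∀ i, k' - θ.τ9.Nmem ≤ i → i ≤ k' → 0 ≤ epsOfRecord θ.ν (gOfRecord₁₀ F N θ P) i)
    (hε1 : ∀ i, k' - θ.τ9.Nmem ≤ i → i ≤ k' → epsOfRecord θ.ν (gOfRecord₁₀ F N θ P) i ≤ 1 / 10)
    {β₀ : ℝ} (hβ₀0 : 0 ≤ β₀) (hβ₀ : β₀ ≤ 1 / 2)
    (hflow : ∀ j, k' - θ.τ9.Nmem ≤ j → j < k' →
      epsOfRecord θ.ν (gOfRecord₁₀ F N θ P) k' ≤ (1 + β₀) * Real.sqrt ((k' - j : ℕ) : ℝ) * epsOfRecord θ.ν (gOfRecord₁₀ F N θ P) j)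
    -- the located geometry, the ℍ-leaves and (1.80)
    (hZk : ∀ m, k' - N₀ < m → m < k' → σ.Zpp k' ∩ omegaOfChain s m ⊆ omegaOfChain s (m + 1))
    (hgeom : ∀ m, D.k₀ < m → m < D.k → ∀ p ∈ plaqsOf (D.Ω m \ D.Ω (m + 1)), 4 * ((m : ℝ) - D.k₀) * D.M ≤ D.dist p)
    (hbox : ∀ p ∈ plaqsOf (half D), D.boxOf p ∈ D.halfcubes ∧ p ∈ D.plaqT (D.boxOf p))
    (L91h : ∀ U, new189 D U → ∀ p ∈ plaqsOf (half D),
      Ineq191 (dist1 (plaqHol (D.Upp U) p)) (D.devV'' U p) D.α ((D.L ^ D.h)⁻¹) (D.ε D.h) (E124 D.ε D.L D.η D.k D.h))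
    (L95 : ∀ U, new189 D U → ∀ p ∈ plaqsOf (half D),
      Ineq195 (D.devV'' U p) (dist1 (plaqHol (D.Uhalf U (D.boxOf p)) p)) D.α ((D.L ^ D.h)⁻¹) (D.ε D.h) (E124 D.ε D.L D.η D.k D.h))
    (L91 : ∀ U, new189 D U → ∀ j, D.h ≤ j → j ≤ D.k → ∀ p ∈ plaqsOf (dom D j),
      Ineq191 (dist1 (plaqHol (D.Upp U) p)) (D.dev97 U p) D.α ((D.L ^ j)⁻¹) (D.ε j) (E124 D.ε D.L D.η D.k j))
    (L97 : ∀ U, new189 D U → ∀ j, D.h ≤ j → j ≤ D.k → ∀ p ∈ plaqsOf (dom D j),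
      Ineq191 (D.dev97 U p) (D.dev0 U p) D.α ((D.L ^ j)⁻¹) (D.ε j) (E124 D.ε D.L D.η D.k j))
    (L80 : ∀ U, new189 D U → ∀ j, D.h ≤ j → j ≤ D.k → ∀ p ∈ plaqsOf (dom D j),
      Ineq180 (D.dev0 U p) (D.ε D.k) D.η D.B₃ D.B₅ D.M D.δ (D.dist p) D.O1) :
    Claim189 (new189 D) (chiPP D) := by
  subst hD
  have hN₀' : (2 + (121 / 120) ^ 2 * (σ.O1 * σ.B₃ * σ.B₅ * (θ.τ9.M : ℝ) ^ 5)) * ((σ.L₀ ^ 2) ^ (k' - (k' - N₀) - 1))⁻¹ ≤ 1 / 4 := by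
    rw [show k' - (k' - N₀) - 1 = N₀ - 1 from by omega]; exact hN₀
  exact claim189_assembly_printed_of_flow (D189OfRecord θ P (sitOfTerm θ P σ s N₀ p₁))
    (pinNumerics_h_le_k₀ (σ.pinTerm s) θ.τ9 N₀ hNN) (pinNumerics_k₀_add_two_le_k (σ.pinTerm s) θ.τ9 N₀ hN2 hNk)
    (omegaOfChain_succ_subset s) (omegaOfChain_top_subset s le_rfl) rfl hβ0 hβ hL₀ hL₀L hε0 hε1
    (pinNumerics_B_nonneg (σ.pinTerm s) θ.τ9 N₀ hB) hδ (Nat.cast_nonneg _) hdist hN₀' hMl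
    (hjEqK_of_nested _ (omegaOfChain_succ_subset s) hZk) hgeom hβ₀0 hβ₀ hflow hbox L91h L95 L91 L97 L80

variable (θ) (lam : ResidW F N) (σT : ∀ P : B12.RunParams, Sit189 F N P.K)
  (sT : ∀ P : B12.RunParams, SeqOfRecord F θ.ν θ.τ9.M (gOfRecord₁₀ F N θ P) P.K (lam.kSel P + 1))

variable {θ} in
/-- **dag-n12-d's `h189` SLOT AT THE TERM-PINNED LAYER FROM ITS `h180` SLOT — WINDOW-FREE FORM** (`h189_pinD189T_of_h180` with the flow inputs `hε0 ∕ hε1 ∕ hflow` DISPLAYED at the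
thresholds of record instead of read off the window). [cite: Balaban1989LargeFieldI, (1.89) p.198, pp.199–200; Balaban1988Convergent, (2.8) p.256] -/
theorem h189_pinD189T_of_h180_of_flow (P : B12.RunParams)
    (hN2 : 2 ≤ N₀) (hNN : N₀ ≤ θ.τ9.Nmem) (hNk : N₀ ≤ lam.kSel P + 1)
    (hβ0 : 0 ≤ (σT P).β) (hβ : (σT P).β ≤ 1 / 4) (hL₀ : 2 ≤ (σT P).L₀) (hL₀L : (σT P).L₀ ^ 2 ≤ ((F.P P.K).L : ℝ))
    (hB : 0 ≤ (σT P).O1 * (σT P).B₃ * (σT P).B₅) (hδ : 0 ≤ (σT P).δ) (hdist : ∀ p, 0 ≤ (σT P).dist p)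
    (hN₀ : (2 + (121 / 120) ^ 2 * ((σT P).O1 * (σT P).B₃ * (σT P).B₅ * (θ.τ9.M : ℝ) ^ 5)) * (((σT P).L₀ ^ 2) ^ (N₀ - 1))⁻¹ ≤ 1 / 4)
    (hMl : (121 / 120) ^ 2 * ((σT P).O1 * (σT P).B₃ * (σT P).B₅ * (θ.τ9.M : ℝ) ^ 5) * Real.exp (-(4 * (σT P).δ * (θ.τ9.M : ℝ))) ≤ 1 / 12)
    (hε0 : ∀ i, lam.kSel P + 1 - θ.τ9.Nmem ≤ i → i ≤ lam.kSel P + 1 → 0 ≤ epsOfRecord θ.ν (gOfRecord₁₀ F N θ P) i)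
    (hε1 : ∀ i, lam.kSel P + 1 - θ.τ9.Nmem ≤ i → i ≤ lam.kSel P + 1 → epsOfRecord θ.ν (gOfRecord₁₀ F N θ P) i ≤ 1 / 10)
    {β₀ : ℝ} (hβ₀0 : 0 ≤ β₀) (hβ₀ : β₀ ≤ 1 / 2)
    (hflow : ∀ j, lam.kSel P + 1 - θ.τ9.Nmem ≤ j → j < lam.kSel P + 1 →
      epsOfRecord θ.ν (gOfRecord₁₀ F N θ P) (lam.kSel P + 1) ≤ (1 + β₀) * Real.sqrt ((lam.kSel P + 1 - j : ℕ) : ℝ) * epsOfRecord θ.ν (gOfRecord₁₀ F N θ P) j)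
    (hZk : ∀ m, lam.kSel P + 1 - N₀ < m → m < lam.kSel P + 1 → (σT P).Zpp (lam.kSel P + 1) ∩ omegaOfChain (sT P) m ⊆ omegaOfChain (sT P) (m + 1))
    (hgeom : ∀ m, ((lam.pinD189T θ σT sT N₀ p₁).D189 P).k₀ < m → m < ((lam.pinD189T θ σT sT N₀ p₁).D189 P).k →
      ∀ p ∈ plaqsOf (((lam.pinD189T θ σT sT N₀ p₁).D189 P).Ω m \ ((lam.pinD189T θ σT sT N₀ p₁).D189 P).Ω (m + 1)),
        4 * ((m : ℝ) - ((lam.pinD189T θ σT sT N₀ p₁).D189 P).k₀) * ((lam.pinD189T θ σT sT N₀ p₁).D189 P).M ≤ ((lam.pinD189T θ σT sT N₀ p₁).D189 P).dist p)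
    (hbox : ∀ p ∈ plaqsOf (half ((lam.pinD189T θ σT sT N₀ p₁).D189 P)),
      ((lam.pinD189T θ σT sT N₀ p₁).D189 P).boxOf p ∈ ((lam.pinD189T θ σT sT N₀ p₁).D189 P).halfcubes ∧
        p ∈ ((lam.pinD189T θ σT sT N₀ p₁).D189 P).plaqT (((lam.pinD189T θ σT sT N₀ p₁).D189 P).boxOf p))
    (L91h : ∀ U, new189 ((lam.pinD189T θ σT sT N₀ p₁).D189 P) U → ∀ p ∈ plaqsOf (half ((lam.pinD189T θ σT sT N₀ p₁).D189 P)),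
      Ineq191 (dist1 (plaqHol (((lam.pinD189T θ σT sT N₀ p₁).D189 P).Upp U) p)) (((lam.pinD189T θ σT sT N₀ p₁).D189 P).devV'' U p)
        ((lam.pinD189T θ σT sT N₀ p₁).D189 P).α ((((lam.pinD189T θ σT sT N₀ p₁).D189 P).L ^ ((lam.pinD189T θ σT sT N₀ p₁).D189 P).h)⁻¹)
        (((lam.pinD189T θ σT sT N₀ p₁).D189 P).ε ((lam.pinD189T θ σT sT N₀ p₁).D189 P).h)
        (E124 ((lam.pinD189T θ σT sT N₀ p₁).D189 P).ε ((lam.pinD189T θ σT sT N₀ p₁).D189 P).L ((lam.pinD189T θ σT sT N₀ p₁).D189 P).η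
          ((lam.pinD189T θ σT sT N₀ p₁).D189 P).k ((lam.pinD189T θ σT sT N₀ p₁).D189 P).h))
    (L95 : ∀ U, new189 ((lam.pinD189T θ σT sT N₀ p₁).D189 P) U → ∀ p ∈ plaqsOf (half ((lam.pinD189T θ σT sT N₀ p₁).D189 P)),
      Ineq195 (((lam.pinD189T θ σT sT N₀ p₁).D189 P).devV'' U p)
        (dist1 (plaqHol (((lam.pinD189T θ σT sT N₀ p₁).D189 P).Uhalf U (((lam.pinD189T θ σT sT N₀ p₁).D189 P).boxOf p)) p))
        ((lam.pinD189T θ σT sT N₀ p₁).D189 P).α ((((lam.pinD189T θ σT sT N₀ p₁).D189 P).L ^ ((lam.pinD189T θ σT sT N₀ p₁).D189 P).h)⁻¹)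
        (((lam.pinD189T θ σT sT N₀ p₁).D189 P).ε ((lam.pinD189T θ σT sT N₀ p₁).D189 P).h)
        (E124 ((lam.pinD189T θ σT sT N₀ p₁).D189 P).ε ((lam.pinD189T θ σT sT N₀ p₁).D189 P).L ((lam.pinD189T θ σT sT N₀ p₁).D189 P).η
          ((lam.pinD189T θ σT sT N₀ p₁).D189 P).k ((lam.pinD189T θ σT sT N₀ p₁).D189 P).h))
    (L91 : ∀ U, new189 ((lam.pinD189T θ σT sT N₀ p₁).D189 P) U → ∀ j, ((lam.pinD189T θ σT sT N₀ p₁).D189 P).h ≤ j → j ≤ ((lam.pinD189T θ σT sT N₀ p₁).D189 P).k →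
      ∀ p ∈ plaqsOf (dom ((lam.pinD189T θ σT sT N₀ p₁).D189 P) j),
        Ineq191 (dist1 (plaqHol (((lam.pinD189T θ σT sT N₀ p₁).D189 P).Upp U) p)) (((lam.pinD189T θ σT sT N₀ p₁).D189 P).dev97 U p)
          ((lam.pinD189T θ σT sT N₀ p₁).D189 P).α ((((lam.pinD189T θ σT sT N₀ p₁).D189 P).L ^ j)⁻¹) (((lam.pinD189T θ σT sT N₀ p₁).D189 P).ε j)
          (E124 ((lam.pinD189T θ σT sT N₀ p₁).D189 P).ε ((lam.pinD189T θ σT sT N₀ p₁).D189 P).L ((lam.pinD189T θ σT sT N₀ p₁).D189 P).η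
            ((lam.pinD189T θ σT sT N₀ p₁).D189 P).k j))
    (L97 : ∀ U, new189 ((lam.pinD189T θ σT sT N₀ p₁).D189 P) U → ∀ j, ((lam.pinD189T θ σT sT N₀ p₁).D189 P).h ≤ j → j ≤ ((lam.pinD189T θ σT sT N₀ p₁).D189 P).k →
      ∀ p ∈ plaqsOf (dom ((lam.pinD189T θ σT sT N₀ p₁).D189 P) j),
        Ineq191 (((lam.pinD189T θ σT sT N₀ p₁).D189 P).dev97 U p) (((lam.pinD189T θ σT sT N₀ p₁).D189 P).dev0 U p)
          ((lam.pinD189T θ σT sT N₀ p₁).D189 P).α ((((lam.pinD189T θ σT sT N₀ p₁).D189 P).L ^ j)⁻¹) (((lam.pinD189T θ σT sT N₀ p₁).D189 P).ε j)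
          (E124 ((lam.pinD189T θ σT sT N₀ p₁).D189 P).ε ((lam.pinD189T θ σT sT N₀ p₁).D189 P).L ((lam.pinD189T θ σT sT N₀ p₁).D189 P).η
            ((lam.pinD189T θ σT sT N₀ p₁).D189 P).k j))
    (h180 : ∀ U, new189 ((lam.pinD189T θ σT sT N₀ p₁).D189 P) U →
      ∀ i, ((lam.pinD189T θ σT sT N₀ p₁).D189 P).h ≤ i → i ≤ ((lam.pinD189T θ σT sT N₀ p₁).D189 P).k →
        ∀ q ∈ plaqsOf (dom ((lam.pinD189T θ σT sT N₀ p₁).D189 P) i),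
          Ineq180 (((lam.pinD189T θ σT sT N₀ p₁).D189 P).dev0 U q) (((lam.pinD189T θ σT sT N₀ p₁).D189 P).ε ((lam.pinD189T θ σT sT N₀ p₁).D189 P).k)
            ((lam.pinD189T θ σT sT N₀ p₁).D189 P).η ((lam.pinD189T θ σT sT N₀ p₁).D189 P).B₃ ((lam.pinD189T θ σT sT N₀ p₁).D189 P).B₅
            ((lam.pinD189T θ σT sT N₀ p₁).D189 P).M ((lam.pinD189T θ σT sT N₀ p₁).D189 P).δ (((lam.pinD189T θ σT sT N₀ p₁).D189 P).dist q)
            ((lam.pinD189T θ σT sT N₀ p₁).D189 P).O1) :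
    Claim189 (new189 ((lam.pinD189T θ σT sT N₀ p₁).D189 P)) (chiPP ((lam.pinD189T θ σT sT N₀ p₁).D189 P)) :=
  claim189_sitOfTerm_of_flow P (σT P) (sT P) N₀ p₁ rfl hN2 hNN hNk hβ0 hβ hL₀ hL₀L hB hδ hdist hN₀ hMl hε0 hε1 hβ₀0 hβ₀ hflow hZk hgeom hbox
    L91h L95 L91 L97 h180

variable {θ} in
/-- **A2 — BOTH [IV] DISPLAYS TESTED AT THE UNIT CONFIGURATION AT THE TERM-PINNED LAYER** (module 10's `displays_tested_at_one_pinD189ν_of_admissible` at the term-pinned situations): in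
the window `]0, γ]` (`γ < 1`) at admissible `θ` with `A₁ > 0`, for a run `P` with `kSel P + 1 ≤ n`, residual `0 ≤ β < 1`, `0 < L₀`, `0 ≤ O(1)B₃B₅`, at `U = (1, 0)`: the antecedent
`new189` HOLDS, the (1.80) body HOLDS, the consequent `χ″_k` of (1.89) HOLDS — neither display is vacuous at the term pin. [cite: Balaban1989LargeFieldI, (1.80) p.195, (1.89) p.198, (1.82) p.196, (1.24) p.182 (bookkeeping witness)] -/
theorem displays_tested_at_one_pinD189T_of_admissible (hθ : θ.Admissible) (hγ1 : θ.γ < 1) (hA₁ : 0 < θ.A₁) (P : B12.RunParams) {n : ℕ}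
    (hI : Step.InInterval θ.γ n (gOfRecord₁₀ F N θ P)) (hkn : lam.kSel P + 1 ≤ n) (hβ0 : 0 ≤ (σT P).β) (hβ1 : (σT P).β < 1) (hL₀ : 0 < (σT P).L₀)
    (hB : 0 ≤ (σT P).O1 * (σT P).B₃ * (σT P).B₅) :
    new189 ((lam.pinD189T θ σT sT N₀ p₁).D189 P) ((1 : MSField (F.P P.K) (SU N)), fun _ _ => (0 : EuclideanSpace ℝ (Fin (N ^ 2 - 1)))) ∧
    (∀ i, ((lam.pinD189T θ σT sT N₀ p₁).D189 P).h ≤ i → i ≤ ((lam.pinD189T θ σT sT N₀ p₁).D189 P).k → ∀ q ∈ plaqsOf (dom ((lam.pinD189T θ σT sT N₀ p₁).D189 P) i),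
      Ineq180 (((lam.pinD189T θ σT sT N₀ p₁).D189 P).dev0 ((1 : MSField (F.P P.K) (SU N)), fun _ _ => (0 : EuclideanSpace ℝ (Fin (N ^ 2 - 1)))) q)
        (((lam.pinD189T θ σT sT N₀ p₁).D189 P).ε ((lam.pinD189T θ σT sT N₀ p₁).D189 P).k) ((lam.pinD189T θ σT sT N₀ p₁).D189 P).η ((lam.pinD189T θ σT sT N₀ p₁).D189 P).B₃
        ((lam.pinD189T θ σT sT N₀ p₁).D189 P).B₅ ((lam.pinD189T θ σT sT N₀ p₁).D189 P).M ((lam.pinD189T θ σT sT N₀ p₁).D189 P).δ (((lam.pinD189T θ σT sT N₀ p₁).D189 P).dist q)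
        ((lam.pinD189T θ σT sT N₀ p₁).D189 P).O1) ∧
    chiPP ((lam.pinD189T θ σT sT N₀ p₁).D189 P) ((1 : MSField (F.P P.K) (SU N)), fun _ _ => (0 : EuclideanSpace ℝ (Fin (N ^ 2 - 1)))) :=
  displays_tested_at_one_pinD189ν_of_admissible lam (fun P => (σT P).pinTerm (sT P)) N₀ p₁ hθ hγ1 hA₁ P hI hkn hβ0 hβ1 hL₀ hB

end WindowFree

end B15Claim189PrintedConditions

end Literature.MathematicalPhysics.QuantumFieldTheory.Balaban1983to89

end
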